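import Literature.Computability.Cryptography.PrincipalCycleWalk
import Literature.Computability.Cryptography.FixedPointLogarithmFP
import Literature.Computability.Cryptography.CEstFP
import Literature.Computability.Cryptography.HallgrenClassGroupXgcdFP
import Literature.Computability.Complexity.CodeFPRat
import Literature.Computability.Complexity.CodeFPBudgets
import Literature.Computability.Complexity.CodeFPLists
import Literature.Computability.Complexity.CodeFPArith
import HarnessLib

/-!
# Hallgren's walk in polynomial time, I: the guarded steps and the evaluators in `CodeFP`

Topic `Computability/Cryptography`; proof companion of `PrincipalCycleWalk.lean` (the walk data
`walkZ D prec` on integer pairs: unit `(unitP D, 2)`, guarded baby step `stepG`, guarded giant step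
`starG = reducePos ∘ compose` under the bounds test `inBounds`, evaluators `ghatQ`, `khatQ`, bound
`Kq`). Theorems only (no definitions, no named facts): each of these maps, as a function of the
binary discriminant `D`, the UNARY precision `prec` and the `intE`-coded integer pairs, is computed on
codes by a polynomial-time string function (`CodeFP`, `Complexity/CodeFP.lean`). The Gauss reduction
is a `foldl` over the unary budget `1^{gaussSteps}` whose accumulator stays polynomially bounded on
ALL inputs because the guarded step keeps `Q ≥ 0`, `4P'² ≤ Q²` and `Q' ≤ D + Q`
(`length_iterate_gaussStepPos_le`); the defect evaluator sums the `logQIApprox` of the reduction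
factors with `ratSum` over a `map`ped `urange` (each factor recomputed from scratch), so no further
growth estimate is needed. Jozsa 2003, §9 Thm. 5: "each step … can be performed in polynomial time".

## References

* R. Jozsa, arXiv:quant-ph/0302134 (2003), §9 Thm. 5. [Jozsa2003]
* S. Arora, B. Barak, *Computational Complexity: A Modern Approach*, CUP 2009, §1.3. [AroraBarak2009]
-/

noncomputable section

namespace Literature.Computability.Cryptography

namespace Hallgren2007

open Literature.NumberTheory.QuadraticFields Literature.NumberTheory.QuadraticFields.QuadIrr
  Literature.Computability.Cryptography.FixedPointLog
open Literature.Computability.Complexity Literature.Computability.Complexity.CodeFP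
open Literature.Algebra.EuclideanLattices (encodeRat)
open Hallgren2005.ClFP (intGcdABC)
open PeriodFinding (ratSub' ratAbs' ratOfInt' ratOfNat')
open Polynomial

variable {D : ℕ}

/-! ### Codes -/

/-- The code of an integer pair `(P, Q)`. [folklore] -/
abbrev zzE : ZZ → List Bool := pairE intE intE

/-- The code of `(D, (P, Q))`. [folklore] -/
abbrev dzE : ℕ × ZZ → List Bool := pairE natE zzE

/-! ### The bounds test, the unit, the guarded baby step -/

/-- `⌊√D⌋` as an integer, on codes. [folklore] -/
theorem natSqrtIntC : CodeFP natE intE (fun D => (Nat.sqrt D : ℤ)) := (intOfNat.comp natSqrt :)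

/-- **`inBounds` on codes.** [folklore] -/
theorem inBoundsC : CodeFP dzE bitE (fun p => decide (inBounds p.1 (ofZ p.2))) := by
  have hD : CodeFP dzE natE (fun p => p.1) := fst _ _
  have hP : CodeFP dzE intE (fun p => p.2.1) := (snd _ _).fst'
  have hQ : CodeFP dzE intE (fun p => p.2.2) := (snd _ _).snd'
  have hs : CodeFP dzE intE (fun p => (Nat.sqrt p.1 : ℤ)) := (natSqrtIntC.comp hD :)
  have h1 : CodeFP dzE intE (fun _ => (1 : ℤ)) := const _ (1 : ℤ)
  have h2s1 : CodeFP dzE intE (fun p => 2 * (Nat.sqrt p.1 : ℤ) + 1) :=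
    (intAdd.comp ((intMul.comp ((const _ (2 : ℤ)).pair hs)).pair h1) :)
  have t1 : CodeFP dzE bitE (fun p => decide ((1 : ℤ) ≤ p.2.1)) := (intLe.comp (h1.pair hP) :)
  have t2 : CodeFP dzE bitE (fun p => decide (p.2.1 ≤ (Nat.sqrt p.1 : ℤ))) := (intLe.comp (hP.pair hs) :)
  have t3 : CodeFP dzE bitE (fun p => decide ((1 : ℤ) ≤ p.2.2)) := (intLe.comp (h1.pair hQ) :)
  have t4 : CodeFP dzE bitE (fun p => decide (p.2.2 ≤ 2 * (Nat.sqrt p.1 : ℤ) + 1)) := (intLe.comp (hQ.pair h2s1) :)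
  have h := (t1.and t2).and (t3.and t4)
  refine h.congr fun p => ?_
  simp only [inBounds, ofZ, Bool.decide_and, Bool.and_assoc]

/-- **`unitP` on codes.** [folklore] -/
theorem unitPC : CodeFP natE intE unitP := by
  have hs : CodeFP natE natE Nat.sqrt := natSqrt
  have hsm : CodeFP natE natE (fun D => Nat.sqrt D % 2) := (natMod.comp (hs.pair (const _ (2 : ℕ))) :)
  have hDm : CodeFP natE natE (fun D => D % 2) := (natMod.comp ((CodeFP.id natE).pair (const _ (2 : ℕ))) :)
  have ht : CodeFP natE bitE (fun D => decide (Nat.sqrt D % 2 = D % 2)) := (natEq.comp (hsm.pair hDm) :)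
  have hsZ : CodeFP natE intE (fun D => (Nat.sqrt D : ℤ)) := natSqrtIntC
  have hs1 : CodeFP natE intE (fun D => (Nat.sqrt D : ℤ) - 1) := (intSub.comp (hsZ.pair (const _ (1 : ℤ))) :)
  have h := ite ht hsZ hs1
  refine h.congr fun D => ?_
  by_cases hc : Nat.sqrt D % 2 = D % 2 <;> simp [unitP, hc]

/-- The unit of the walk `(unitP D, 2)` on codes. [folklore] -/
theorem unitZC : CodeFP natE zzE (fun D => ((unitP D, 2) : ZZ)) := (unitPC.pair (const _ (2 : ℤ)) :)

/-- **The guarded baby step on codes** (the integer formula of `stepG_eq_formula`). [cite: JacobsonWilliams2008, §3.1 (3.11)] -/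
theorem stepGC : CodeFP dzE zzE (fun p => toZ (stepG p.1 (ofZ p.2))) := by
  have hD : CodeFP dzE intE (fun p => (p.1 : ℤ)) := (intOfNat.comp (fst _ _) :)
  have hP : CodeFP dzE intE (fun p => p.2.1) := (snd _ _).fst'
  have hQ : CodeFP dzE intE (fun p => p.2.2) := (snd _ _).snd'
  have hs : CodeFP dzE intE (fun p => (Nat.sqrt p.1 : ℤ)) := (natSqrtIntC.comp (fst _ _) :)
  have hq : CodeFP dzE intE (fun p => (p.2.1 + (Nat.sqrt p.1 : ℤ)) / p.2.2) := (intEDiv.comp ((intAdd.comp (hP.pair hs)).pair hQ) :)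
  have hP' : CodeFP dzE intE (fun p => (p.2.1 + (Nat.sqrt p.1 : ℤ)) / p.2.2 * p.2.2 - p.2.1) :=
    (intSub.comp ((intMul.comp (hq.pair hQ)).pair hP) :)
  have hQ' : CodeFP dzE intE (fun p => ((p.1 : ℤ) - ((p.2.1 + (Nat.sqrt p.1 : ℤ)) / p.2.2 * p.2.2 - p.2.1) ^ 2) / p.2.2) := by
    have hsq : CodeFP dzE intE (fun p => ((p.2.1 + (Nat.sqrt p.1 : ℤ)) / p.2.2 * p.2.2 - p.2.1) ^ 2) :=
      (intMul.comp (hP'.pair hP')).congr fun p => (sq _).symm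
    exact (intEDiv.comp ((intSub.comp (hD.pair hsq)).pair hQ) :)
  have hthen : CodeFP dzE zzE (fun p => (((p.2.1 + (Nat.sqrt p.1 : ℤ)) / p.2.2 * p.2.2 - p.2.1,
      ((p.1 : ℤ) - ((p.2.1 + (Nat.sqrt p.1 : ℤ)) / p.2.2 * p.2.2 - p.2.1) ^ 2) / p.2.2) : ZZ)) := (hP'.pair hQ' :)
  have helse : CodeFP dzE zzE (fun p => p.2) := snd _ _
  have tout : CodeFP dzE bitE (fun p => decide (inBounds p.1 (ofZ ((p.2.1 + (Nat.sqrt p.1 : ℤ)) / p.2.2 * p.2.2 - p.2.1,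
      ((p.1 : ℤ) - ((p.2.1 + (Nat.sqrt p.1 : ℤ)) / p.2.2 * p.2.2 - p.2.1) ^ 2) / p.2.2)))) :=
    (inBoundsC.comp ((fst _ _).pair hthen) :)
  have h := ite (inBoundsC.and tout) hthen helse
  refine h.congr fun p => ?_
  obtain ⟨D, P, Q⟩ := p
  show (if (decide (inBounds D (ofZ (P, Q))) && decide _) = true then _ else _) = toZ (stepG D (ofZ (P, Q)))
  rw [← Bool.decide_and, stepG_eq_formula]
  simp only [ofZ, toZ]
  by_cases hb : inBounds D (⟨P, Q⟩ : QuadIrr D) ∧ inBounds D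
      (⟨(P + Nat.sqrt D) / Q * Q - P, ((D : ℤ) - ((P + Nat.sqrt D) / Q * Q - P) ^ 2) / Q⟩ : QuadIrr D)
  · simp [hb]
  · simp [hb]

/-! ### The guarded Gauss reduction -/

/-- `gaussRaw` on codes: `q = (2P + Q) div 2Q`, `(qQ − P, (D − (qQ − P)²)/Q)`. [cite: Jozsa2003, §6.2 Prop. 21] -/
theorem gaussRawC : CodeFP dzE zzE (fun p => toZ (gaussRaw (ofZ p.2) : QuadIrr p.1)) := by
  have hD : CodeFP dzE intE (fun p => (p.1 : ℤ)) := (intOfNat.comp (fst _ _) :)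
  have hP : CodeFP dzE intE (fun p => p.2.1) := (snd _ _).fst'
  have hQ : CodeFP dzE intE (fun p => p.2.2) := (snd _ _).snd'
  have h2 : CodeFP dzE intE (fun _ => (2 : ℤ)) := const _ (2 : ℤ)
  have hq : CodeFP dzE intE (fun p => (2 * p.2.1 + p.2.2) / (2 * p.2.2)) :=
    (intEDiv.comp ((intAdd.comp ((intMul.comp (h2.pair hP)).pair hQ)).pair (intMul.comp (h2.pair hQ))) :)
  have hP' : CodeFP dzE intE (fun p => (2 * p.2.1 + p.2.2) / (2 * p.2.2) * p.2.2 - p.2.1) :=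
    (intSub.comp ((intMul.comp (hq.pair hQ)).pair hP) :)
  have hsq : CodeFP dzE intE (fun p => ((2 * p.2.1 + p.2.2) / (2 * p.2.2) * p.2.2 - p.2.1) ^ 2) :=
    (intMul.comp (hP'.pair hP')).congr fun p => (sq _).symm
  have hQ' : CodeFP dzE intE (fun p => ((p.1 : ℤ) - ((2 * p.2.1 + p.2.2) / (2 * p.2.2) * p.2.2 - p.2.1) ^ 2) / p.2.2) :=
    (intEDiv.comp ((intSub.comp (hD.pair hsq)).pair hQ) :)
  have h := hP'.pair hQ'
  refine h.congr fun p => ?_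
  rfl

/-- **The guarded Gauss step on codes.** [cite: Jozsa2003, §6.2 Prop. 21] -/
theorem gaussStepPosC : CodeFP dzE zzE (fun p => toZ (gaussStepPos (ofZ p.2) : QuadIrr p.1)) := by
  have hD : CodeFP dzE intE (fun p => (p.1 : ℤ)) := (intOfNat.comp (fst _ _) :)
  have hQ : CodeFP dzE intE (fun p => p.2.2) := (snd _ _).snd'
  have hz : CodeFP dzE zzE (fun p => p.2) := snd _ _
  have hraw := gaussRawC
  have hrawQ : CodeFP dzE intE (fun p => (toZ (gaussRaw (ofZ p.2) : QuadIrr p.1)).2) := hraw.snd'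
  have hflip : CodeFP dzE zzE (fun p => ((toZ (gaussRaw (ofZ p.2) : QuadIrr p.1)).1, -(toZ (gaussRaw (ofZ p.2) : QuadIrr p.1)).2)) :=
    (hraw.fst'.pair (intNeg.comp hrawQ) :)
  have t0 : CodeFP dzE bitE (fun p => decide ((0 : ℤ) ≤ p.2.2)) := (intLe.comp ((const _ (0 : ℤ)).pair hQ) :)
  have hQsq : CodeFP dzE intE (fun p => p.2.2 ^ 2) := (intMul.comp (hQ.pair hQ)).congr fun p => (sq _).symm
  have t1 : CodeFP dzE bitE (fun p => decide (p.2.2 ^ 2 < (p.1 : ℤ))) := (intLt.comp (hQsq.pair hD) :)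
  have t2 : CodeFP dzE bitE (fun p => decide ((0 : ℤ) < (toZ (gaussRaw (ofZ p.2) : QuadIrr p.1)).2)) :=
    (intLt.comp ((const _ (0 : ℤ)).pair hrawQ) :)
  have hinner := ite t2 hraw hflip
  have hgs := ite t1 hz hinner
  have h := ite t0 hgs hz
  refine h.congr fun p => ?_
  obtain ⟨D, P, Q⟩ := p
  simp only [gaussStepPos, gaussStep, ofZ, toZ, flipQ]
  by_cases h0 : (0 : ℤ) ≤ Q
  · simp only [h0, decide_true, if_true]
    by_cases h1 : Q ^ 2 < (D : ℤ)
    · simp [h1]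
    · simp only [h1, decide_false, if_false, Bool.false_eq_true]
      by_cases h2 : 0 < (gaussRaw (⟨P, Q⟩ : QuadIrr D)).Q
      · simp [h2]
      · simp [h2]
  · simp [h0]

/-- `Nat.log 4 n = (Nat.log 2 n) / 2`. [folklore] -/
theorem log_four_eq (n : ℕ) : Nat.log 4 n = Nat.log 2 n / 2 := by
  rcases Nat.eq_zero_or_pos n with rfl | hn
  · simp
  set e := Nat.log 2 n
  have h1 : 2 ^ e ≤ n := Nat.pow_log_le_self 2 hn.ne'
  have h2 : n < 2 ^ (e + 1) := Nat.lt_pow_succ_log_self one_lt_two n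
  apply Nat.log_eq_of_pow_le_of_lt_pow
  · calc 4 ^ (e / 2) = 2 ^ (2 * (e / 2)) := by rw [pow_mul]; norm_num
      _ ≤ 2 ^ e := Nat.pow_le_pow_right (by norm_num) (by omega)
      _ ≤ n := h1
  · calc n < 2 ^ (e + 1) := h2
      _ ≤ 2 ^ (2 * (e / 2 + 1)) := Nat.pow_le_pow_right (by norm_num) (by omega)
      _ = 4 ^ (e / 2 + 1) := by rw [pow_mul]; norm_num

/-- **The step count `gaussSteps` in unary** (`log₄ Q + 3 ≤ size Q + 3`). [cite: Jozsa2003, §6.2 Prop. 21] -/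
theorem gaussStepsUnC : CodeFP intE unE (fun Q => Nat.log 4 Q.toNat + 3) := by
  have hn : CodeFP intE natE Int.toNat := intToNat
  have hl2 : CodeFP intE natE (fun Q => Nat.log 2 Q.toNat) := (natLog2C.comp hn :)
  have hl4 : CodeFP intE natE (fun Q => Nat.log 2 Q.toNat / 2) := (natDiv.comp (hl2.pair (const _ (2 : ℕ))) :)
  have hcap : CodeFP intE unE (fun Q => Nat.size Q.toNat) := (sizeUnC.comp hn :)
  have hu : CodeFP intE unE (fun Q => min (Nat.log 2 Q.toNat / 2) (Nat.size Q.toNat)) := (unOfNatMin.comp (hcap.pair hl4) :)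
  have h3 : CodeFP intE unE (fun Q => min (Nat.log 2 Q.toNat / 2) (Nat.size Q.toNat) + 1 + 1 + 1) :=
    (unSucc.comp (unSucc.comp (unSucc.comp hu)) :)
  refine h3.congr fun Q => ?_
  rw [log_four_eq]
  have : Nat.log 2 Q.toNat / 2 ≤ Nat.size Q.toNat := by
    have := min_size_log Q.toNat
    have h : Nat.log 2 Q.toNat ≤ Nat.size Q.toNat := by rw [← this]; exact min_le_left _ _
    omega
  rw [min_eq_left this]

/-! #### Size bounds along the guarded Gauss iteration -/

/-- Integer division bound: `a ≤ D`, `4a ≥ −Q²`, `Q > 0` give `|a div Q| ≤ D + Q + 1`. [folklore] -/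
theorem abs_ediv_le_of {a Q D : ℤ} (hQ : 0 < Q) (hD : 0 ≤ D) (h1 : a ≤ D) (h2 : -(Q ^ 2) ≤ 4 * a) :
    |a / Q| ≤ D + Q + 1 := by
  set r := a / Q with hr
  have e1 : r * Q ≤ a := Int.ediv_mul_le a hQ.ne'
  have e2 : a < (r + 1) * Q := by
    have := Int.lt_ediv_add_one_mul_self a hQ; linarith
  rw [abs_le]
  constructor
  · -- `(r + 1) Q > a ≥ −Q²/4`, so `r + 1 > −Q/4`
    nlinarith
  · -- `r Q ≤ a ≤ D`, so `r ≤ D`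
    nlinarith

/-- `(stepWith x q).Q = (D − P'²) div Q`. [cite: JacobsonWilliams2008, §3.1 (3.11)] -/
theorem stepWith_Q_eq (x : QuadIrr D) (q : ℤ) : (stepWith x q).Q = ((D : ℤ) - (stepWith x q).P ^ 2) / x.Q := rfl

/-- **One guarded Gauss step on ALL inputs with `Q ≥ 0`**: `Q' ≥ 0`, `|P'| ≤ max |P| Q`,
`Q' ≤ D + Q + 1`. [cite: Jozsa2003, §6.2 Prop. 21 (|b'| ≤ a, the new a is (D − b'²)/4a up to sign)] -/
theorem gaussStepPos_bounds (x : QuadIrr D) (hQ : 0 ≤ x.Q) :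
    0 ≤ (gaussStepPos x).Q ∧ |(gaussStepPos x).P| ≤ max |x.P| x.Q ∧ (gaussStepPos x).Q ≤ (D : ℤ) + x.Q + 1 := by
  have hgs : gaussStepPos x = gaussStep x := by simp [gaussStepPos, hQ]
  rw [hgs]
  refine ⟨gaussStep_Q_nonneg hQ, ?_⟩
  by_cases h1 : x.Q ^ 2 < (D : ℤ)
  · have : gaussStep x = x := by rw [gaussStep, if_pos h1]
    rw [this]
    exact ⟨le_max_left _ _, by linarith⟩
  · -- the raw step is taken (possibly with the sign of `Q'` flipped)
    have hres : (gaussStep x).P = (gaussRaw x).P ∧ (gaussStep x).Q = |(gaussRaw x).Q| := by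
      unfold gaussStep
      rw [if_neg h1]
      split_ifs with h2
      · exact ⟨rfl, (abs_of_pos h2).symm⟩
      · refine ⟨rfl, ?_⟩
        show -(gaussRaw x).Q = |(gaussRaw x).Q|
        rw [abs_of_nonpos (not_lt.mp h2)]
    rw [hres.1, hres.2]
    rcases hQ.lt_or_eq with hQ0 | hQ0
    · -- `Q > 0`
      have hPsq := sq_gaussRaw_P_le hQ0 (x := x)
      have hP : |(gaussRaw x).P| ≤ x.Q := by
        have h0 : 0 ≤ x.Q := hQ
        nlinarith [sq_abs (gaussRaw x).P, abs_nonneg (gaussRaw x).P]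
      refine ⟨hP.trans (le_max_right _ _), ?_⟩
      rw [gaussRaw, stepWith_Q_eq, ← gaussRaw]
      apply abs_ediv_le_of hQ0 (by positivity)
      · nlinarith [sq_nonneg (gaussRaw x).P]
      · nlinarith
    · -- `Q = 0`: `P' = −P`, `Q' = 0`
      have hP' : (gaussRaw x).P = -x.P := by rw [gaussRaw, stepWith_P, ← hQ0]; ring
      have hQ' : (gaussRaw x).Q = 0 := by rw [gaussRaw, stepWith_Q_eq, ← gaussRaw, ← hQ0, Int.ediv_zero]
      rw [hP', hQ', abs_neg, abs_zero]
      exact ⟨le_max_left _ _, by linarith⟩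

/-- **Along `n` guarded Gauss steps** (from `Q ≥ 0`): `Q ≥ 0`, `Q ≤ Q₀ + n(D + 1)` and
`|P| ≤ |P₀| + Q₀ + n(D + 1)`. [cite: Jozsa2003, §6.2 Prop. 21] -/
theorem iterate_gaussStepPos_bounds (x : QuadIrr D) (hQ : 0 ≤ x.Q) :
    ∀ n : ℕ, 0 ≤ (gaussStepPos^[n] x).Q ∧ (gaussStepPos^[n] x).Q ≤ x.Q + n * ((D : ℤ) + 1) ∧
      |(gaussStepPos^[n] x).P| ≤ |x.P| + x.Q + n * ((D : ℤ) + 1)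
  | 0 => ⟨hQ, by simp, by simp; exact hQ⟩
  | n + 1 => by
    obtain ⟨i1, i2, i3⟩ := iterate_gaussStepPos_bounds x hQ n
    obtain ⟨b1, b2, b3⟩ := gaussStepPos_bounds _ i1
    rw [Function.iterate_succ_apply']
    refine ⟨b1, ?_, ?_⟩
    · push_cast; linarith
    · push_cast
      refine b2.trans (max_le ?_ ?_) <;> linarith [abs_nonneg x.P]

/-- Off `Q ≥ 0` the guarded iteration is the identity. [folklore] -/
theorem iterate_gaussStepPos_of_neg (x : QuadIrr D) (hQ : x.Q < 0) : ∀ n : ℕ, gaussStepPos^[n] x = x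
  | 0 => rfl
  | n + 1 => by
    rw [Function.iterate_succ_apply, show gaussStepPos x = x by simp [gaussStepPos, not_le.mpr hQ]]
    exact iterate_gaussStepPos_of_neg x hQ n


/-! ### The guarded Gauss iteration as a bounded fold -/

/-- Iterating along a unit list is a fold. [folklore] -/
theorem foldl_units_eq_iterate {β : Type*} (f : β → β) (b : β) (l : List Unit) :
    l.foldl (fun b _ => f b) b = f^[l.length] b := by
  induction l generalizing b with
  | nil => rfl
  | cons _ l ih => rw [List.foldl_cons, ih, List.length_cons, Function.iterate_succ_apply]

/-- Transport of iteration along `toZ`/`ofZ`. [folklore] -/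
theorem iterate_toZ (f : QuadIrr D → QuadIrr D) (n : ℕ) (z : ZZ) :
    (fun w => toZ (f (ofZ w)))^[n] z = toZ (f^[n] (ofZ z)) := by
  induction n generalizing z with
  | zero => simp
  | succ n ih => rw [Function.iterate_succ_apply, ih, Function.iterate_succ_apply, ofZ_toZ]

/-- `size (a + b) ≤ size a + size b + 1`. [folklore] -/
theorem size_add_le' (a b : ℕ) : Nat.size (a + b) ≤ Nat.size a + Nat.size b + 1 := by
  have := size_add_le a b
  have h1 := le_max_left (Nat.size a) (Nat.size b)
  have h2 := le_max_right (Nat.size a) (Nat.size b)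
  rcases le_total (Nat.size a) (Nat.size b) with h | h
  · rw [max_eq_right h] at this; omega
  · rw [max_eq_left h] at this; omega

/-- The length of the code of an integer pair with both entries `≤ B` in absolute value. [folklore] -/
theorem length_zzE_le {z : ZZ} {B : ℕ} (h1 : |z.1| ≤ B) (h2 : |z.2| ≤ B) : (zzE z).length ≤ 9 * Nat.size B + 8 := by
  rw [show zzE z = boolPair (intE z.1) (intE z.2) from rfl, length_boolPair]
  have := Hallgren2005.ClFP.length_intE_le_of_abs_le h1
  have := Hallgren2005.ClFP.length_intE_le_of_abs_le h2
  omega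

/-- **The guarded Gauss iteration on codes** (`n` unary): a fold whose accumulator obeys the
unconditional bounds `iterate_gaussStepPos_bounds`. [cite: Jozsa2003, §6.2 Prop. 21; AroraBarak2009, §1.3] -/
theorem gaussIterPosC : CodeFP (pairE dzE unE) zzE
    (fun p => toZ (gaussStepPos^[p.2] (ofZ p.1.2) : QuadIrr p.1.1)) := by
  have hstep : CodeFP (pairE dzE (pairE unitE zzE)) zzE (fun t => toZ (gaussStepPos (ofZ t.2.2) : QuadIrr t.1.1)) :=
    (gaussStepPosC.comp ((fst _ _).fst'.pair (snd _ _).snd') :)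
  have hinit : CodeFP dzE zzE (fun s => s.2) := snd _ _
  have h := foldl (σ := ℕ × ZZ) (α := Unit) (β := ZZ) (eσ := dzE) (eα := unitE) (eβ := zzE)
    (step := fun s _ b => toZ (gaussStepPos (ofZ b) : QuadIrr s.1)) (init := fun s => s.2) hstep hinit
    (C 36 * X + C 80) (fun s l₁ l₂ => by
      obtain ⟨D, P, Q⟩ := s
      rw [foldl_units_eq_iterate, iterate_toZ]
      simp only [eval_add, eval_mul, eval_C, eval_X, pairE_apply, length_boolPair]
      set n := l₁.length
      set L := 2 * (2 * (natE D).length + 2 + (zzE (P, Q)).length) + 2 + (rawE unitE (l₁ ++ l₂)).length with hL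
      -- sizes of the components are `≤ L`
      have hzz : (zzE (P, Q)).length = 2 * (intE P).length + 2 + (intE Q).length := by
        rw [show zzE (P, Q) = boolPair (intE P) (intE Q) from rfl, length_boolPair]
      have hP0 : Nat.size P.natAbs ≤ L := by have := size_natAbs_le_length_intE P; omega
      have hQ0 : Nat.size Q.natAbs ≤ L := by have := size_natAbs_le_length_intE Q; omega
      have hD0 : Nat.size D ≤ L := by rw [← length_natE]; omega
      have hn0 : n ≤ L := by
        have := length_le_length_rawE unitE (l₁ ++ l₂)
        rw [List.length_append] at this; omega
      -- the bound on the iterate: `B = |P| + |Q| + (n+1)(D+2)`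
      have hmono : (n : ℤ) * ((D : ℤ) + 1) ≤ (n + 1) * ((D : ℤ) + 2) := by nlinarith
      have hBZ : ((P.natAbs + Q.natAbs + (n + 1) * (D + 2) : ℕ) : ℤ) = |P| + |Q| + (n + 1) * ((D : ℤ) + 2) := by
        push_cast; ring
      have hbd : |(gaussStepPos^[n] (ofZ (P, Q) : QuadIrr D)).P| ≤ (P.natAbs + Q.natAbs + (n + 1) * (D + 2) : ℕ) ∧
          |(gaussStepPos^[n] (ofZ (P, Q) : QuadIrr D)).Q| ≤ (P.natAbs + Q.natAbs + (n + 1) * (D + 2) : ℕ) := by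
        rw [hBZ]
        have hP0' := abs_nonneg P
        have hQ0' := abs_nonneg Q
        rcases le_or_gt 0 Q with hQ | hQ
        · obtain ⟨i1, i2, i3⟩ := iterate_gaussStepPos_bounds (ofZ (P, Q) : QuadIrr D) hQ n
          simp only [ofZ] at i1 i2 i3 ⊢
          have hQa : Q ≤ |Q| := le_abs_self Q
          constructor
          · linarith
          · rw [abs_of_nonneg i1]; linarith
        · rw [iterate_gaussStepPos_of_neg _ (by exact hQ)]
          simp only [ofZ]
          have : (0 : ℤ) ≤ (n + 1) * ((D : ℤ) + 2) := by positivity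
          constructor <;> linarith
      have hlen := length_zzE_le (z := toZ (gaussStepPos^[n] (ofZ (P, Q) : QuadIrr D))) hbd.1 hbd.2
      rw [show ∀ z : ZZ, zzE z = boolPair (intE z.1) (intE z.2) from fun _ => rfl, length_boolPair] at hlen
      -- `size B ≤ 4L + 8`
      have hsB : Nat.size (P.natAbs + Q.natAbs + (n + 1) * (D + 2)) ≤ 4 * L + 8 := by
        have h1 := size_add_le' (P.natAbs + Q.natAbs) ((n + 1) * (D + 2))
        have h2 := size_add_le' P.natAbs Q.natAbs
        have h3 := size_mul_le (n + 1) (D + 2)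
        have h4 := size_add_le' n 1
        have h5 := size_add_le' D 2
        have h6 : Nat.size 1 = 1 := by decide
        have h7 : Nat.size 2 = 2 := by decide
        have h8 : Nat.size n ≤ n := Nat.size_le.2 (Nat.lt_two_pow_self)
        omega
      omega)
  have h' := h.comp ((fst _ _).pair (replicateUnit.comp (snd dzE unE)))
  refine h'.congr fun p => ?_
  show (List.replicate p.2 ()).foldl (fun b _ => toZ (gaussStepPos (ofZ b) : QuadIrr p.1.1)) p.1.2 = _
  rw [foldl_units_eq_iterate, iterate_toZ, List.length_replicate]

/-- **The guarded normalisation on codes.** [folklore] -/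
theorem normalizePosC : CodeFP dzE zzE (fun p => toZ (normalizePos (ofZ p.2) : QuadIrr p.1)) := by
  have hP : CodeFP dzE intE (fun p => p.2.1) := (snd _ _).fst'
  have hQ : CodeFP dzE intE (fun p => p.2.2) := (snd _ _).snd'
  have hs : CodeFP dzE intE (fun p => (Nat.sqrt p.1 : ℤ)) := (natSqrtIntC.comp (fst _ _) :)
  have hk : CodeFP dzE intE (fun p => ((Nat.sqrt p.1 : ℤ) - p.2.1) / p.2.2) := (intEDiv.comp ((intSub.comp (hs.pair hP)).pair hQ) :)
  have hthen : CodeFP dzE zzE (fun p => ((p.2.1 + ((Nat.sqrt p.1 : ℤ) - p.2.1) / p.2.2 * p.2.2, p.2.2) : ZZ)) :=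
    ((intAdd.comp (hP.pair (intMul.comp (hk.pair hQ)))).pair hQ :)
  have t : CodeFP dzE bitE (fun p => decide ((0 : ℤ) < p.2.2)) := (intLt.comp ((const _ (0 : ℤ)).pair hQ) :)
  have h := ite t hthen (snd _ _)
  refine h.congr fun p => ?_
  obtain ⟨D, P, Q⟩ := p
  simp only [normalizePos, ofZ, toZ, shiftP]
  by_cases h0 : (0 : ℤ) < Q <;> simp [h0]

/-- **The guarded reduction on codes** (`gaussSteps` guarded Gauss steps, then normalise). [cite: Jozsa2003, §6.2 Prop. 21] -/
theorem reducePosC : CodeFP dzE zzE (fun p => toZ (reducePos (ofZ p.2) : QuadIrr p.1)) := by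
  have hn : CodeFP dzE unE (fun p => Nat.log 4 p.2.2.toNat + 3) := (gaussStepsUnC.comp (snd _ _).snd' :)
  have hit : CodeFP dzE zzE (fun p => toZ (gaussStepPos^[Nat.log 4 p.2.2.toNat + 3] (ofZ p.2) : QuadIrr p.1)) :=
    (gaussIterPosC.comp ((CodeFP.id dzE).pair hn) :)
  have h := normalizePosC.comp ((fst _ _).pair hit)
  exact h.congr fun p => rfl

/-! ### Composition and the guarded giant step -/

/-- The code of `(D, (a, b))`. [folklore] -/
abbrev dzzE : ℕ × ZZ × ZZ → List Bool := pairE natE (pairE zzE zzE)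

/-- **`compose` on codes** (the integer formula with two extended Euclids). [cite: Jozsa2003, §7.1 Prop. 34; Cohen1993, Alg. 5.4.7] -/
theorem composeC : CodeFP dzzE zzE (fun p => toZ (compose (ofZ p.2.1) (ofZ p.2.2) : QuadIrr p.1)) := by
  have hD : CodeFP dzzE intE (fun p => (p.1 : ℤ)) := (intOfNat.comp (fst _ _) :)
  have hP₁ : CodeFP dzzE intE (fun p => p.2.1.1) := (snd _ _).fst'.fst'
  have hQ₁ : CodeFP dzzE intE (fun p => p.2.1.2) := (snd _ _).fst'.snd'
  have hP₂ : CodeFP dzzE intE (fun p => p.2.2.1) := (snd _ _).snd'.fst'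
  have hQ₂ : CodeFP dzzE intE (fun p => p.2.2.2) := (snd _ _).snd'.snd'
  have h2 : CodeFP dzzE intE (fun _ => (2 : ℤ)) := const _ (2 : ℤ)
  -- `fa`, `fc`, `s`
  have hfa₁ : CodeFP dzzE intE (fun p => p.2.1.2 / 2) := (intEDiv.comp (hQ₁.pair h2) :)
  have hfa₂ : CodeFP dzzE intE (fun p => p.2.2.2 / 2) := (intEDiv.comp (hQ₂.pair h2) :)
  have hP₁sq : CodeFP dzzE intE (fun p => p.2.1.1 ^ 2) := (intMul.comp (hP₁.pair hP₁)).congr fun p => (sq _).symm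
  have hfc₁ : CodeFP dzzE intE (fun p => (p.2.1.1 ^ 2 - (p.1 : ℤ)) / (2 * p.2.1.2)) :=
    (intEDiv.comp ((intSub.comp (hP₁sq.pair hD)).pair (intMul.comp (h2.pair hQ₁))) :)
  have hs : CodeFP dzzE intE (fun p => (p.2.1.1 + p.2.2.1) / 2) := (intEDiv.comp ((intAdd.comp (hP₁.pair hP₂)).pair h2) :)
  -- first Euclid: `gcd(fa₁, fa₂)`, `gcdA`, `gcdB`
  have hg₁ := intGcdABC.comp (hfa₁.pair hfa₂)
  have hg₁Z : CodeFP dzzE intE (fun p => (Int.gcd (p.2.1.2 / 2) (p.2.2.2 / 2) : ℤ)) := (intOfNat.comp hg₁.fst' :)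
  have hA₀ : CodeFP dzzE intE (fun p => Int.gcdA (p.2.1.2 / 2) (p.2.2.2 / 2)) := hg₁.snd'.fst'
  have hB₀ : CodeFP dzzE intE (fun p => Int.gcdB (p.2.1.2 / 2) (p.2.2.2 / 2)) := hg₁.snd'.snd'
  -- second Euclid: `g = gcd(g₁, s)`, `gcdA`, `gcdB`
  have hg := intGcdABC.comp (hg₁Z.pair hs)
  have hgZ : CodeFP dzzE intE (fun p => (Int.gcd (Int.gcd (p.2.1.2 / 2) (p.2.2.2 / 2) : ℤ) ((p.2.1.1 + p.2.2.1) / 2) : ℤ)) :=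
    (intOfNat.comp hg.fst' :)
  have hA₁' : CodeFP dzzE intE (fun p => Int.gcdA (Int.gcd (p.2.1.2 / 2) (p.2.2.2 / 2) : ℤ) ((p.2.1.1 + p.2.2.1) / 2)) := hg.snd'.fst'
  have hW : CodeFP dzzE intE (fun p => Int.gcdB (Int.gcd (p.2.1.2 / 2) (p.2.2.2 / 2) : ℤ) ((p.2.1.1 + p.2.2.1) / 2)) := hg.snd'.snd'
  have hU : CodeFP dzzE intE (fun p => Int.gcdA (Int.gcd (p.2.1.2 / 2) (p.2.2.2 / 2) : ℤ) ((p.2.1.1 + p.2.2.1) / 2) *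
      Int.gcdA (p.2.1.2 / 2) (p.2.2.2 / 2)) := (intMul.comp (hA₁'.pair hA₀) :)
  have hV : CodeFP dzzE intE (fun p => Int.gcdA (Int.gcd (p.2.1.2 / 2) (p.2.2.2 / 2) : ℤ) ((p.2.1.1 + p.2.2.1) / 2) *
      Int.gcdB (p.2.1.2 / 2) (p.2.2.2 / 2)) := (intMul.comp (hA₁'.pair hB₀) :)
  -- `A₁ = fa₁/g`, `A₂ = fa₂/g`, `S = s/g`
  have hA₁ := intEDiv.comp (hfa₁.pair hgZ)
  have hA₂ := intEDiv.comp (hfa₂.pair hgZ)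
  have hS := intEDiv.comp (hs.pair hgZ)
  -- `B = U A₁ P₂ + V A₂ P₁ + W (S P₁ − 2 A₁ c₁)`, `Q₃ = 2 A₁ A₂`
  have hB := intAdd.comp ((intAdd.comp ((intMul.comp ((intMul.comp (hU.pair hA₁)).pair hP₂)).pair
    (intMul.comp ((intMul.comp (hV.pair hA₂)).pair hP₁)))).pair
    (intMul.comp (hW.pair (intSub.comp ((intMul.comp (hS.pair hP₁)).pair (intMul.comp ((intMul.comp (h2.pair hA₁)).pair hfc₁)))))))
  have hQ₃ := intMul.comp ((intMul.comp (h2.pair hA₁)).pair hA₂)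
  have h := hB.pair hQ₃
  refine h.congr fun p => ?_
  obtain ⟨D, ⟨P₁, Q₁⟩, ⟨P₂, Q₂⟩⟩ := p
  rfl

/-- **The guarded giant step on codes** (`reducePos ∘ compose` under the bounds test). [cite: Jozsa2003, §7.1 Prop. 35] -/
theorem starGC : CodeFP dzzE zzE (fun p => toZ (starG p.1 (ofZ p.2.1) (ofZ p.2.2))) := by
  have hD : CodeFP dzzE natE (fun p => p.1) := fst _ _
  have ha : CodeFP dzzE zzE (fun p => p.2.1) := (snd _ _).fst'
  have hb : CodeFP dzzE zzE (fun p => p.2.2) := (snd _ _).snd'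
  have ta : CodeFP dzzE bitE (fun p => decide (inBounds p.1 (ofZ p.2.1))) := (inBoundsC.comp (hD.pair ha) :)
  have tb : CodeFP dzzE bitE (fun p => decide (inBounds p.1 (ofZ p.2.2))) := (inBoundsC.comp (hD.pair hb) :)
  have hred : CodeFP dzzE zzE (fun p => toZ (reducePos (ofZ (toZ (compose (ofZ p.2.1) (ofZ p.2.2) : QuadIrr p.1))) : QuadIrr p.1)) :=
    (reducePosC.comp (hD.pair composeC) :)
  have tr : CodeFP dzzE bitE (fun p => decide (inBounds p.1 (ofZ (toZ (reducePos (ofZ (toZ (compose (ofZ p.2.1) (ofZ p.2.2) : QuadIrr p.1))) : QuadIrr p.1))))) :=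
    (inBoundsC.comp (hD.pair hred) :)
  have h := ite (ta.and (tb.and tr)) hred ha
  refine h.congr fun p => ?_
  obtain ⟨D, a, b⟩ := p
  show (if (decide (inBounds D (ofZ a)) && (decide (inBounds D (ofZ b)) && decide _)) = true then _ else _) =
    toZ (starG D (ofZ a) (ofZ b))
  rw [← Bool.decide_and, ← Bool.decide_and, starG_eq_pos]
  simp only [ofZ_toZ]
  by_cases hc : inBounds D (ofZ a) ∧ inBounds D (ofZ b) ∧ inBounds D (reducePos (compose (ofZ a) (ofZ b)))
  · simp [hc]
  · simp [hc]


/-! ### The evaluators `ĝ`, `k̂` and the bound `Kq` -/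

/-- The code of `(D, (prec, z))` (precision unary). [folklore] -/
abbrev dpzE : ℕ × ℕ × ZZ → List Bool := pairE natE (pairE unE zzE)

/-- **`ghatQ` on codes**: `dyRound prec (logQIApprox D P' Q' prec)` at `(P', Q') = stepG`. [cite: Jozsa2003, §9 Thm. 5] -/
theorem ghatQC : CodeFP dpzE encodeRat (fun p => ghatQ p.1 p.2.1 (ofZ p.2.2)) := by
  have hD : CodeFP dpzE natE (fun p => p.1) := fst _ _
  have hprec : CodeFP dpzE unE (fun p => p.2.1) := (snd _ _).fst'
  have hz : CodeFP dpzE zzE (fun p => p.2.2) := (snd _ _).snd'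
  have hst : CodeFP dpzE zzE (fun p => toZ (stepG p.1 (ofZ p.2.2))) := (stepGC.comp (hD.pair hz) :)
  have hl : CodeFP dpzE encodeRat (fun p => logQIApprox p.1 (toZ (stepG p.1 (ofZ p.2.2))).1 (toZ (stepG p.1 (ofZ p.2.2))).2 p.2.1) :=
    (logQIApproxC.comp (hD.pair (hst.fst'.pair (hst.snd'.pair hprec))) :)
  have h := dyRoundC.comp (hprec.pair hl)
  exact h.congr fun p => rfl

/-- `Ks D = log₄(2D) + 3` on codes. [folklore] -/
theorem KsC : CodeFP natE natE Ks := by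
  have h2D : CodeFP natE natE (fun D => 2 * D) := (natMul.comp ((const _ (2 : ℕ)).pair (CodeFP.id natE)) :)
  have hl : CodeFP natE natE (fun D => Nat.log 2 (2 * D) / 2) := (natDiv.comp ((natLog2C.comp h2D).pair (const _ (2 : ℕ))) :)
  have h := natAdd.comp (hl.pair (const _ (3 : ℕ)))
  refine h.congr fun D => ?_
  show Nat.log 2 (2 * D) / 2 + 3 = Ks D
  rw [Ks, log_four_eq]

/-- **`Kq D` on codes.** [folklore] -/
theorem KqC : CodeFP natE encodeRat Kq := by
  have hs : CodeFP natE natE Nat.size := (natOfUn.comp sizeUnC :)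
  have h23 : CodeFP natE natE (fun D => 2 * Nat.size D + 3) :=
    (natAdd.comp ((natMul.comp ((const _ (2 : ℕ)).pair hs)).pair (const _ (3 : ℕ))) :)
  have hn : CodeFP natE natE (fun D => Ks D * (2 * Nat.size D + 3) + Nat.size D) :=
    (natAdd.comp ((natMul.comp (KsC.pair h23)).pair hs) :)
  exact (ratOfNat'.comp hn).congr fun D => rfl

/-- Comparison of rationals (`p ≤ q ↔ 0 ≤ num(q − p)`). [folklore] -/
private theorem ratLeC : CodeFP (pairE encodeRat encodeRat) bitE (fun p => decide (p.1 ≤ p.2)) := by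
  have hd : CodeFP (pairE encodeRat encodeRat) encodeRat (fun p => p.2 - p.1) := (ratSub'.comp ((snd _ _).pair (fst _ _)) :)
  have hn : CodeFP (pairE encodeRat encodeRat) intE (fun p => (p.2 - p.1).num) := (ratNumDen.comp hd).fst'
  have h := intLe.comp ((const _ (0 : ℤ)).pair hn)
  refine h.congr fun p => ?_
  show decide ((0 : ℤ) ≤ (p.2 - p.1).num) = decide (p.1 ≤ p.2)
  have : ((0 : ℤ) ≤ (p.2 - p.1).num) ↔ (p.1 ≤ p.2) := by rw [Rat.num_nonneg, sub_nonneg]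
  simp only [this]

/-- `min` of rationals. [folklore] -/
private theorem ratMinC : CodeFP (pairE encodeRat encodeRat) encodeRat (fun p => min p.1 p.2) := by
  have h := ite ratLeC (fst encodeRat encodeRat) (snd encodeRat encodeRat)
  refine h.congr fun p => ?_
  show (if decide (p.1 ≤ p.2) = true then p.1 else p.2) = min p.1 p.2
  by_cases hc : p.1 ≤ p.2
  · simp [hc]
  · simp [hc, min_eq_right (not_le.mp hc).le]

/-- `max` of rationals. [folklore] -/
private theorem ratMaxC : CodeFP (pairE encodeRat encodeRat) encodeRat (fun p => max p.1 p.2) := by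
  have h := ite ratLeC (snd encodeRat encodeRat) (fst encodeRat encodeRat)
  refine h.congr fun p => ?_
  show (if decide (p.1 ≤ p.2) = true then p.2 else p.1) = max p.1 p.2
  by_cases hc : p.1 ≤ p.2
  · simp [hc]
  · simp [hc, max_eq_left (not_le.mp hc).le]

/-- **`clampQ` on codes.** [folklore] -/
theorem clampQC : CodeFP (pairE encodeRat encodeRat) encodeRat (fun p => clampQ p.1 p.2) := by
  have hK : CodeFP (pairE encodeRat encodeRat) encodeRat (fun p => p.1) := fst _ _
  have hq : CodeFP (pairE encodeRat encodeRat) encodeRat (fun p => p.2) := snd _ _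
  have hnK : CodeFP (pairE encodeRat encodeRat) encodeRat (fun p => -p.1) :=
    ((ratMul.comp ((const _ (-1 : ℚ)).pair hK)).congr fun p => by show (-1) * p.1 = -p.1; ring)
  have h := ratMaxC.comp (hnK.pair (ratMinC.comp (hK.pair hq)))
  exact h.congr fun p => rfl

/-- `logFactorApprox` on codes. [cite: JacobsonWilliams2008, §11.2] -/
theorem logFactorApproxC : CodeFP dpzE encodeRat (fun p => logFactorApprox p.1 p.2.1 (ofZ p.2.2)) := by
  have hD : CodeFP dpzE natE (fun p => p.1) := fst _ _
  have hDZ : CodeFP dpzE intE (fun p => (p.1 : ℤ)) := (intOfNat.comp hD :)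
  have hprec : CodeFP dpzE unE (fun p => p.2.1) := (snd _ _).fst'
  have hz : CodeFP dpzE zzE (fun p => p.2.2) := (snd _ _).snd'
  have hQ : CodeFP dpzE intE (fun p => p.2.2.2) := hz.snd'
  have hQsq : CodeFP dpzE intE (fun p => p.2.2.2 ^ 2) := (intMul.comp (hQ.pair hQ)).congr fun p => (sq _).symm
  have t : CodeFP dpzE bitE (fun p => decide (p.2.2.2 ^ 2 < (p.1 : ℤ))) := (intLt.comp (hQsq.pair hDZ) :)
  have hraw : CodeFP dpzE zzE (fun p => toZ (gaussRaw (ofZ p.2.2) : QuadIrr p.1)) := (gaussRawC.comp (hD.pair hz) :)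
  have hl : CodeFP dpzE encodeRat (fun p => logQIApprox p.1 (toZ (gaussRaw (ofZ p.2.2) : QuadIrr p.1)).1
      (toZ (gaussRaw (ofZ p.2.2) : QuadIrr p.1)).2 p.2.1) :=
    (logQIApproxC.comp (hD.pair (hraw.fst'.pair (hraw.snd'.pair hprec))) :)
  have h := ite t (const _ (0 : ℚ)) hl
  refine h.congr fun p => ?_
  obtain ⟨D, prec, P, Q⟩ := p
  show (if decide (Q ^ 2 < (D : ℤ)) = true then (0 : ℚ) else _) = logFactorApprox D prec ⟨P, Q⟩
  unfold logFactorApprox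
  by_cases hc : Q ^ 2 < (D : ℤ)
  · simp [hc]
  · simp [hc, toZ, ofZ]

/-- The code of `(D, (prec, (a, b)))`. [folklore] -/
abbrev dpzzE : ℕ × ℕ × ZZ × ZZ → List Bool := pairE natE (pairE unE (pairE zzE zzE))

/-- The sum of the factor logarithms along the guarded reduction of `z`, as the program computes it:
`∑_{i<K} logFactorApprox (gaussStepPosⁱ z)`, `K = gaussSteps z`. [cite: JacobsonWilliams2008, §11.2] -/
theorem factorSumC : CodeFP dpzE encodeRat (fun p =>
    (((List.range (gaussSteps (ofZ p.2.2 : QuadIrr p.1))).map fun i =>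
      logFactorApprox p.1 p.2.1 (gaussStepPos^[i] (ofZ p.2.2) : QuadIrr p.1))).sum) := by
  -- context `σ = (D, prec, z, K)` with `K` unary
  let σE : (ℕ × ℕ × ZZ) × ℕ → List Bool := pairE dpzE unE
  have hK : CodeFP dpzE unE (fun p => gaussSteps (ofZ p.2.2 : QuadIrr p.1)) :=
    ((gaussStepsUnC.comp (snd _ _).snd'.snd').congr fun p => rfl)
  have hD : CodeFP (pairE σE natE) natE (fun t => t.1.1.1) := (fst _ _).fst'.fst'
  have hprec : CodeFP (pairE σE natE) unE (fun t => t.1.1.2.1) := (fst _ _).fst'.snd'.fst'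
  have hz : CodeFP (pairE σE natE) zzE (fun t => t.1.1.2.2) := (fst _ _).fst'.snd'.snd'
  have hKu : CodeFP (pairE σE natE) unE (fun t => t.1.2) := (fst _ _).snd'
  have hi : CodeFP (pairE σE natE) natE (fun t => t.2) := snd _ _
  have hiu : CodeFP (pairE σE natE) unE (fun t => min t.2 t.1.2) := (unOfNatMin.comp (hKu.pair hi) :)
  have hit : CodeFP (pairE σE natE) zzE (fun t => toZ (gaussStepPos^[min t.2 t.1.2] (ofZ t.1.1.2.2) : QuadIrr t.1.1.1)) :=
    (gaussIterPosC.comp ((hD.pair hz).pair hiu) :)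
  have hterm : CodeFP (pairE σE natE) encodeRat (fun t => logFactorApprox t.1.1.1 t.1.1.2.1
      (ofZ (toZ (gaussStepPos^[min t.2 t.1.2] (ofZ t.1.1.2.2) : QuadIrr t.1.1.1)))) :=
    (logFactorApproxC.comp (hD.pair (hprec.pair hit)) :)
  have hmap := map (σ := (ℕ × ℕ × ZZ) × ℕ) (eσ := σE) hterm
  have hl : CodeFP σE (rawE natE) (fun s => List.range s.2) := (urange.comp (snd _ _) :)
  have hσ : CodeFP dpzE σE (fun p => (p, gaussSteps (ofZ p.2.2 : QuadIrr p.1))) := (CodeFP.id dpzE).pair hK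
  have h := ratSum.comp (hmap.comp ((CodeFP.id σE).pair hl)) |>.comp hσ
  refine h.congr fun p => ?_
  obtain ⟨D, prec, z⟩ := p
  show (((List.range (gaussSteps (ofZ z : QuadIrr D))).map fun i => logFactorApprox D prec
    (ofZ (toZ (gaussStepPos^[min i (gaussSteps (ofZ z : QuadIrr D))] (ofZ z) : QuadIrr D)))).sum) = _
  congr 1
  refine List.map_congr_left fun i hi => ?_
  rw [List.mem_range] at hi
  rw [min_eq_left hi.le, ofZ_toZ]

/-- **`khatQ` on codes** (guard, factor sum, `log g`, rounding, clamp). [cite: Jozsa2003, §9 Thm. 5] -/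
theorem khatQC : CodeFP dpzzE encodeRat (fun p => khatQ p.1 p.2.1 (ofZ p.2.2.1) (ofZ p.2.2.2)) := by
  have hD : CodeFP dpzzE natE (fun p => p.1) := fst _ _
  have hprec : CodeFP dpzzE unE (fun p => p.2.1) := (snd _ _).fst'
  have ha : CodeFP dpzzE zzE (fun p => p.2.2.1) := (snd _ _).snd'.fst'
  have hb : CodeFP dpzzE zzE (fun p => p.2.2.2) := (snd _ _).snd'.snd'
  have hz : CodeFP dpzzE zzE (fun p => toZ (compose (ofZ p.2.2.1) (ofZ p.2.2.2) : QuadIrr p.1)) := (composeC.comp (hD.pair (ha.pair hb)) :)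
  have hsum := factorSumC.comp (hD.pair (hprec.pair hz))
  -- `g = gcd(gcd(fa a, fa b), s)` as a natural number
  have h2 : CodeFP dpzzE intE (fun _ => (2 : ℤ)) := const _ (2 : ℤ)
  have hfa₁ : CodeFP dpzzE intE (fun p => p.2.2.1.2 / 2) := (intEDiv.comp (ha.snd'.pair h2) :)
  have hfa₂ : CodeFP dpzzE intE (fun p => p.2.2.2.2 / 2) := (intEDiv.comp (hb.snd'.pair h2) :)
  have hs : CodeFP dpzzE intE (fun p => (p.2.2.1.1 + p.2.2.2.1) / 2) := (intEDiv.comp ((intAdd.comp (ha.fst'.pair hb.fst')).pair h2) :)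
  have hg₁ : CodeFP dpzzE intE (fun p => (Int.gcd (p.2.2.1.2 / 2) (p.2.2.2.2 / 2) : ℤ)) :=
    (intOfNat.comp (intGcdABC.comp (hfa₁.pair hfa₂)).fst' :)
  have hg : CodeFP dpzzE natE (fun p => Int.gcd (Int.gcd (p.2.2.1.2 / 2) (p.2.2.2.2 / 2) : ℤ) ((p.2.2.1.1 + p.2.2.2.1) / 2)) :=
    (intGcdABC.comp (hg₁.pair hs)).fst'
  have hlg := logNatApproxC.comp (hg.pair hprec)
  have hraw : CodeFP dpzzE encodeRat (fun p => dyRound p.2.1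
      ((((List.range (gaussSteps (ofZ (toZ (compose (ofZ p.2.2.1) (ofZ p.2.2.2) : QuadIrr p.1)) : QuadIrr p.1))).map fun i =>
        logFactorApprox p.1 p.2.1 (gaussStepPos^[i] (ofZ (toZ (compose (ofZ p.2.2.1) (ofZ p.2.2.2) : QuadIrr p.1))) : QuadIrr p.1))).sum +
      logNatApprox (Int.gcd (Int.gcd (p.2.2.1.2 / 2) (p.2.2.2.2 / 2) : ℤ) ((p.2.2.1.1 + p.2.2.2.1) / 2)) p.2.1)) :=
    (dyRoundC.comp (hprec.pair (ratAdd.comp (hsum.pair hlg))) :)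
  have ta : CodeFP dpzzE bitE (fun p => decide (inBounds p.1 (ofZ p.2.2.1))) := (inBoundsC.comp (hD.pair ha) :)
  have tb : CodeFP dpzzE bitE (fun p => decide (inBounds p.1 (ofZ p.2.2.2))) := (inBoundsC.comp (hD.pair hb) :)
  have hif := ite (ta.and tb) hraw (const _ (0 : ℚ))
  have hK : CodeFP dpzzE encodeRat (fun p => Kq p.1) := (KqC.comp hD :)
  have h := clampQC.comp (hK.pair hif)
  refine h.congr fun p => ?_
  obtain ⟨D, prec, a, b⟩ := p
  show clampQ (Kq D) (if (decide (inBounds D (ofZ a)) && decide (inBounds D (ofZ b))) = true then _ else 0) =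
    khatQ D prec (ofZ a) (ofZ b)
  unfold khatQ
  congr 1
  rw [← Bool.decide_and]
  by_cases hc : inBounds D (ofZ a) ∧ inBounds D (ofZ b)
  · simp only [hc, and_self, decide_true, if_true]
    unfold khatApprox
    simp only [ofZ_toZ]
    congr 1
    -- the factor sum over the genuine Gauss iteration, and `g`
    have hQ0 := compose_Q_nonneg_of_inBounds hc.1 hc.2
    congr 1
    rw [← sum_map_range]
    congr 1
    refine List.map_congr_left fun i _ => ?_
    rw [(iterate_gaussStepPos_eq hQ0 i).1]
  · simp [hc]


/-! ### Unconditional magnitude bounds for the numerics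

The fold accumulators of the walk carry rational distances; their codes stay short on ALL inputs
because every evaluator is bounded in terms of the sizes of its arguments (no hypothesis on `D`). -/

section Magnitudes

/-- `0 ≤ logSeries x n ≤ n` for `0 ≤ x ≤ 1`. [folklore] -/
theorem logSeries_bounds {x : ℚ} (h0 : 0 ≤ x) (h1 : x ≤ 1) (n : ℕ) : 0 ≤ logSeries x n ∧ logSeries x n ≤ n := by
  unfold logSeries
  constructor
  · exact Finset.sum_nonneg fun i _ => by positivity
  · calc ∑ i ∈ Finset.range n, x ^ (i + 1) / (i + 1 : ℚ) ≤ ∑ _i ∈ Finset.range n, (1 : ℚ) := by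
          refine Finset.sum_le_sum fun i _ => ?_
          have hp : x ^ (i + 1) ≤ 1 := pow_le_one₀ h0 h1
          have hi : (1 : ℚ) ≤ (i + 1 : ℚ) := by
            have : (0 : ℚ) ≤ i := by positivity
            linarith
          rw [div_le_one (by positivity)]
          linarith
      _ = n := by simp

/-- `0 ≤ log2Approx n ≤ 1`. [folklore] -/
theorem log2Approx_bounds (n : ℕ) : 0 ≤ log2Approx n ∧ log2Approx n ≤ 1 := by
  unfold log2Approx logSeries
  constructor
  · exact Finset.sum_nonneg fun i _ => by positivity
  · calc ∑ i ∈ Finset.range n, (1 / 2 : ℚ) ^ (i + 1) / (i + 1 : ℚ) ≤ ∑ i ∈ Finset.range n, (1 / 2 : ℚ) ^ (i + 1) := by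
          refine Finset.sum_le_sum fun i _ => ?_
          have hi : (1 : ℚ) ≤ (i + 1 : ℚ) := by
            have : (0 : ℚ) ≤ i := by positivity
            linarith
          exact div_le_self (by positivity) hi
      _ ≤ 1 := by
          have h := geom_sum_Ico_le_of_lt_one (x := (1 / 2 : ℚ)) (m := 1) (n := n + 1) (by norm_num) (by norm_num)
          have e : ∑ i ∈ Finset.range n, (1 / 2 : ℚ) ^ (i + 1) = ∑ i ∈ Finset.Ico 1 (n + 1), (1 / 2 : ℚ) ^ i := by
            rw [Finset.sum_Ico_eq_sum_range]; simp [add_comm]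
          rw [e]
          refine h.trans ?_
          norm_num

/-- **`0 ≤ logNatApprox n a ≤ log₂ n + a + 1`** on ALL inputs. [folklore] -/
theorem logNatApprox_bounds (n a : ℕ) : 0 ≤ logNatApprox n a ∧ logNatApprox n a ≤ Nat.log 2 n + a + 1 := by
  unfold logNatApprox
  set e := Nat.log 2 n
  set x : ℚ := ((n : ℚ) - 2 ^ e) / n with hx
  have hx01 : 0 ≤ x ∧ x ≤ 1 := by
    rcases Nat.eq_zero_or_pos n with rfl | hn
    · simp [hx]
    · have hpow : (2 : ℚ) ^ e ≤ n := by exact_mod_cast Nat.pow_log_le_self 2 hn.ne'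
      have hnq : (0 : ℚ) < n := by exact_mod_cast hn
      constructor
      · rw [hx]; exact div_nonneg (by linarith) hnq.le
      · rw [hx, div_le_one hnq]; linarith [show (0:ℚ) ≤ 2 ^ e by positivity]
  obtain ⟨hs0, hs1⟩ := logSeries_bounds hx01.1 hx01.2 (a + 1)
  obtain ⟨hl0, hl1⟩ := log2Approx_bounds (a + 1 + e)
  have he0 : (0 : ℚ) ≤ e := by positivity
  push_cast at hs1
  constructor
  · positivity
  · nlinarith [mul_le_mul_of_nonneg_left hl1 he0]

/-- `log₂ n ≤ size n`. (as `Khot.log2_le_size` of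
`EuclideanLattices/KhotParamsFP.lean`, not imported here; a private copy). [folklore] -/
private theorem log_two_le_size (n : ℕ) : Nat.log 2 n ≤ Nat.size n := by
  have := min_size_log n
  rw [← this]; exact min_le_left _ _

/-- **`|logRatApprox q a| ≤ size |num q| + size den q + a + 2`** on ALL inputs. [folklore] -/
theorem abs_logRatApprox_le (q : ℚ) (a : ℕ) :
    |logRatApprox q a| ≤ Nat.size q.num.natAbs + Nat.size q.den + a + 2 := by
  unfold logRatApprox
  obtain ⟨h1, h2⟩ := logNatApprox_bounds q.num.natAbs (a + 1)
  obtain ⟨h3, h4⟩ := logNatApprox_bounds q.den (a + 1)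
  have h5 : (Nat.log 2 q.num.natAbs : ℚ) ≤ Nat.size q.num.natAbs := by exact_mod_cast log_two_le_size _
  have h6 : (Nat.log 2 q.den : ℚ) ≤ Nat.size q.den := by exact_mod_cast log_two_le_size _
  rw [abs_le]; push_cast at *; constructor <;> linarith

/-- `Nat.sqrt (D · 4ᵇ) ≤ (D + 1) · 2ᵇ`. [folklore] -/
theorem sqrt_mul_four_pow_le (D b : ℕ) : Nat.sqrt (D * 4 ^ b) ≤ (D + 1) * 2 ^ b := by
  have h4 : 4 ^ b = (2 ^ b) * (2 ^ b) := by rw [← mul_pow]; norm_num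
  calc Nat.sqrt (D * 4 ^ b) ≤ Nat.sqrt (((D + 1) * 2 ^ b) * ((D + 1) * 2 ^ b)) :=
        Nat.sqrt_le_sqrt (by rw [h4]; nlinarith [Nat.zero_le (2 ^ b), Nat.zero_le D])
    _ = (D + 1) * 2 ^ b := Nat.sqrt_eq _

/-- Numerator and denominator of `(m : ℚ)/k`: `|num| ≤ |m|`, `den ≤ k` (`k > 0`). [folklore] -/
theorem num_den_div_le (m : ℤ) {k : ℕ} (hk : 0 < k) :
    ((m : ℚ) / k).num.natAbs ≤ m.natAbs ∧ ((m : ℚ) / k).den ≤ k := by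
  set q : ℚ := (m : ℚ) / k with hq
  have hkq : (k : ℚ) ≠ 0 := by exact_mod_cast hk.ne'
  have hcross : q.num * k = m * q.den := by
    have h1 : q * k = m := by rw [hq]; field_simp
    have : (q.num : ℚ) * k = m * q.den := by rw [← Rat.mul_den_eq_num, ← h1]; ring
    exact_mod_cast this
  have hcop : Nat.Coprime q.den q.num.natAbs := q.reduced.symm
  have hdvd : q.den ∣ k := by
    have h1 : (q.den : ℤ) ∣ q.num * k := ⟨m, by rw [hcross]; ring⟩
    have h2 : q.den ∣ q.num.natAbs * k := by
      have := Int.natAbs_dvd_natAbs.mpr h1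
      rwa [Int.natAbs_natCast, Int.natAbs_mul, Int.natAbs_natCast] at this
    exact hcop.dvd_of_dvd_mul_left h2
  have hden : q.den ≤ k := Nat.le_of_dvd hk hdvd
  refine ⟨?_, hden⟩
  have h := congrArg Int.natAbs hcross
  rw [Int.natAbs_mul, Int.natAbs_mul, Int.natAbs_natCast, Int.natAbs_natCast] at h
  have h2 : q.num.natAbs * k ≤ m.natAbs * k := by rw [h]; exact Nat.mul_le_mul_left _ hden
  exact Nat.le_of_mul_le_mul_right h2 hk

/-- **`|logQIApprox D P Q a| ≤ 4a + 3·size(D + |P| + 1) + size |Q| + 15`** on ALL inputs. [folklore] -/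
theorem abs_logQIApprox_le (D : ℕ) (P Q : ℤ) (a : ℕ) :
    |logQIApprox D P Q a| ≤ 4 * a + 3 * Nat.size (D + P.natAbs + 1) + Nat.size Q.natAbs + 15 := by
  unfold logQIApprox
  set b := sqrtPrec D P a with hb
  set t := sqrtShiftApprox D P b with ht
  -- `|t| = |m| / 2^b`, `m = P 2^b + S`
  set m : ℤ := P * 2 ^ b + (Nat.sqrt (D * 4 ^ b) : ℕ) with hm
  have htm : |t| = ((|m| : ℤ) : ℚ) / ((2 ^ b : ℕ) : ℚ) := by
    rw [Int.cast_abs]; push_cast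
    rw [ht, sqrtShiftApprox, ← hm, abs_div, abs_of_pos (by positivity : (0:ℚ) < 2 ^ b)]
  obtain ⟨hnum, hden⟩ := num_den_div_le (|m|) (k := 2 ^ b) (by positivity)
  rw [← htm] at hnum hden
  have hS := sqrt_mul_four_pow_le D b
  have hmabs : (|m|).natAbs ≤ (P.natAbs + D + 1) * 2 ^ b := by
    rw [Int.natAbs_abs, hm]
    calc (P * 2 ^ b + (Nat.sqrt (D * 4 ^ b) : ℕ)).natAbs ≤ (P * 2 ^ b).natAbs + ((Nat.sqrt (D * 4 ^ b) : ℕ) : ℤ).natAbs :=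
          Int.natAbs_add_le _ _
      _ ≤ P.natAbs * 2 ^ b + (D + 1) * 2 ^ b := by
          rw [Int.natAbs_mul, Int.natAbs_natCast]
          have : ((2 : ℤ) ^ b).natAbs = 2 ^ b := by rw [Int.natAbs_pow]; rfl
          rw [this]; omega
      _ = (P.natAbs + D + 1) * 2 ^ b := by ring
  have h1 := abs_logRatApprox_le |t| (a + 2)
  have hsz1 : Nat.size (|t|.num.natAbs) ≤ Nat.size (D + P.natAbs + 1) + b + 1 := by
    have := Nat.size_le_size (hnum.trans hmabs)
    refine this.trans ?_
    have := size_mul_le (P.natAbs + D + 1) (2 ^ b)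
    rw [Nat.size_pow] at this
    rw [show D + P.natAbs + 1 = P.natAbs + D + 1 by ring]
    omega
  have hsz2 : Nat.size (|t|.den) ≤ b + 1 := by
    have := Nat.size_le_size hden
    rw [Nat.size_pow] at this; exact this
  obtain ⟨h3, h4⟩ := logNatApprox_bounds Q.natAbs (a + 2)
  have h5 : (Nat.log 2 Q.natAbs : ℚ) ≤ Nat.size Q.natAbs := by exact_mod_cast log_two_le_size _
  have hbq : (b : ℚ) = a + 3 + (Nat.size (D + P.natAbs) : ℚ) := by
    rw [show b = a + 3 + Nat.size (D + P.natAbs) from rfl]; push_cast; ring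
  have hsz3 : (Nat.size (D + P.natAbs) : ℚ) ≤ Nat.size (D + P.natAbs + 1) := by
    exact_mod_cast Nat.size_le_size (by omega)
  have hsz1q : (Nat.size (|t|.num.natAbs) : ℚ) ≤ Nat.size (D + P.natAbs + 1) + b + 1 := by exact_mod_cast hsz1
  have hsz2q : (Nat.size (|t|.den) : ℚ) ≤ b + 1 := by exact_mod_cast hsz2
  rw [abs_le] at h1 ⊢
  push_cast at h1 h4 ⊢
  constructor <;> linarith [h1.1, h1.2]

/-- `|dyRound a q| ≤ |q| + 1`. [folklore] -/
theorem abs_dyRound_le (a : ℕ) (q : ℚ) : |dyRound a q| ≤ |q| + 1 := by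
  have h := abs_dyRound_sub_le a q
  have h1 : ((1 : ℝ) / 2) ^ a ≤ 1 := pow_le_one₀ (by norm_num) (by norm_num)
  have h2 : |((dyRound a q : ℚ) : ℝ)| ≤ |(q : ℝ)| + 1 := by
    have := abs_sub_abs_le_abs_sub ((dyRound a q : ℚ) : ℝ) (q : ℝ)
    linarith
  have h3 : ((|dyRound a q| : ℚ) : ℝ) ≤ ((|q| + 1 : ℚ) : ℝ) := by push_cast; exact h2
  exact_mod_cast h3

/-- `dyRound a q` is a dyadic of order `a`. [folklore] -/
theorem dyRound_dyadic (a : ℕ) (q : ℚ) : ∃ m : ℤ, dyRound a q = m / 2 ^ a := ⟨⌊q * 2 ^ a⌋, rfl⟩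

end Magnitudes

/-! ### Invariants of the walk states (on ALL inputs)

Every state `(z, d̂)` the program holds has `z` within the bounds test or equal to the unit
(`ZGood`, by the output guards of `stepG`/`starG`), and `d̂` a dyadic of order `prec` bounded by an
explicit envelope; hence its code is linearly bounded in the input length. -/

section Invariants

open WalkData

variable (D prec : ℕ)

/-- The integer pair is within the bounds or is the unit pair. [folklore] -/
def ZGood (z : ZZ) : Prop := inBounds D (ofZ z) ∨ z = (unitP D, 2)

/-- The bound on the entries of a good pair: `2⌊√D⌋ + 2`. [folklore] -/
def zB : ℕ := 2 * Nat.sqrt D + 2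

/-- Good pairs have entries `≤ zB` in absolute value. [folklore] -/
theorem ZGood.bounds {z : ZZ} (h : ZGood D z) : |z.1| ≤ (zB D : ℕ) ∧ |z.2| ≤ (zB D : ℕ) := by
  unfold zB
  rcases h with h | rfl
  · obtain ⟨h1, h2, h3, h4⟩ := h
    simp only [ofZ] at h1 h2 h3 h4
    push_cast
    constructor <;> rw [abs_le] <;> constructor <;> linarith
  · unfold unitP
    push_cast
    constructor
    · split_ifs <;> rw [abs_le] <;> constructor <;> linarith
    · rw [abs_le]; constructor <;> linarith

/-- The unit is good. [folklore] -/
theorem zGood_unit : ZGood D (walkZ D prec).unit := Or.inr rfl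

/-- `rho` preserves goodness. [folklore] -/
theorem zGood_rho {z : ZZ} (h : ZGood D z) : ZGood D ((walkZ D prec).rho z) := by
  show ZGood D (toZ (stepG D (ofZ z)))
  rcases stepG_inBounds_or D (ofZ z) with h1 | h1
  · left; rwa [ofZ_toZ]
  · rw [h1, toZ_ofZ]; exact h

/-- `star` preserves goodness (of the first argument). [folklore] -/
theorem zGood_star {z w : ZZ} (h : ZGood D z) : ZGood D ((walkZ D prec).star z w) := by
  show ZGood D (toZ (starG D (ofZ z) (ofZ w)))
  rcases starG_inBounds_or D (ofZ z) (ofZ w) with h1 | h1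
  · left; rwa [ofZ_toZ]
  · rw [h1, toZ_ofZ]; exact h

/-- The envelope of the gap evaluator on good pairs: `Gb = 4 prec + 4 size(3D + 3) + 16`. [folklore] -/
def Gb : ℕ := 4 * prec + 4 * Nat.size (3 * D + 3) + 16

/-- **`ĝ` is a bounded dyadic** on good pairs. [folklore] -/
theorem ghat_bounds {z : ZZ} (h : ZGood D z) :
    (∃ m : ℤ, (walkZ D prec).ghat z = m / 2 ^ prec) ∧ |(walkZ D prec).ghat z| ≤ (Gb D prec : ℕ) := by
  show (∃ m : ℤ, ghatQ D prec (ofZ z) = m / 2 ^ prec) ∧ |ghatQ D prec (ofZ z)| ≤ (Gb D prec : ℕ)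
  unfold ghatQ
  refine ⟨dyRound_dyadic _ _, ?_⟩
  have hg : ZGood D (toZ (stepG D (ofZ z))) := zGood_rho D prec h
  obtain ⟨b1, b2⟩ := hg.bounds
  simp only [toZ] at b1 b2
  have h1 := abs_dyRound_le prec (logQIApprox D (stepG D (ofZ z)).P (stepG D (ofZ z)).Q prec)
  have h2 := abs_logQIApprox_le D (stepG D (ofZ z)).P (stepG D (ofZ z)).Q prec
  -- sizes: `D + |P| + 1 ≤ 3D + 3`, `|Q| ≤ 3D + 3`
  have hs : Nat.sqrt D ≤ D := Nat.sqrt_le_self D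
  unfold zB at b1 b2
  push_cast at b1 b2
  rw [Int.abs_eq_natAbs] at b1 b2
  have hP : (stepG D (ofZ z)).P.natAbs ≤ 2 * D + 2 := by omega
  have hQ : (stepG D (ofZ z)).Q.natAbs ≤ 3 * D + 3 := by omega
  have hz1 : (Nat.size (D + (stepG D (ofZ z)).P.natAbs + 1) : ℚ) ≤ Nat.size (3 * D + 3) := by
    exact_mod_cast Nat.size_le_size (by omega)
  have hz2 : (Nat.size (stepG D (ofZ z)).Q.natAbs : ℚ) ≤ Nat.size (3 * D + 3) := by exact_mod_cast Nat.size_le_size hQ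
  unfold Gb; push_cast at h2 ⊢
  linarith

/-- `Kq D` is a natural number. [folklore] -/
theorem Kq_natCast : ((Ks D * (2 * Nat.size D + 3) + Nat.size D : ℕ) : ℚ) = Kq D := rfl

/-- **`k̂` is a bounded dyadic** (clamped to `[−Kq, Kq]`). [folklore] -/
theorem khat_bounds (z w : ZZ) :
    (∃ m : ℤ, (walkZ D prec).khat z w = m / 2 ^ prec) ∧ |(walkZ D prec).khat z w| ≤ Kq D := by
  show (∃ m : ℤ, khatQ D prec (ofZ z) (ofZ w) = m / 2 ^ prec) ∧ |khatQ D prec (ofZ z) (ofZ w)| ≤ Kq D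
  have hK0 : (0 : ℚ) ≤ Kq D := by rw [← Kq_natCast]; positivity
  refine ⟨?_, abs_clampQ_le hK0 _⟩
  unfold khatQ clampQ
  -- the clamp returns `±Kq` (integers) or the rounded value (a dyadic)
  set q : ℚ := if inBounds D (ofZ z) ∧ inBounds D (ofZ w) then khatApprox D prec (ofZ z) (ofZ w) else 0 with hq
  have hqd : ∃ m : ℤ, q = m / 2 ^ prec := by
    rw [hq]; split_ifs
    · exact dyRound_dyadic _ _
    · exact ⟨0, by simp⟩
  have hKd : ∃ m : ℤ, Kq D = m / 2 ^ prec :=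
    ⟨(Ks D * (2 * Nat.size D + 3) + Nat.size D : ℕ) * 2 ^ prec, by rw [← Kq_natCast]; push_cast; field_simp⟩
  obtain ⟨mq, hmq⟩ := hqd
  obtain ⟨mK, hmK⟩ := hKd
  rcases le_total (Kq D) q with h1 | h1
  · rw [min_eq_left h1]
    rcases le_total (-Kq D) (Kq D) with h2 | h2
    · rw [max_eq_right h2]; exact ⟨mK, hmK⟩
    · rw [max_eq_left h2]; exact ⟨-mK, by rw [hmK]; push_cast; ring⟩
  · rw [min_eq_right h1]
    rcases le_total (-Kq D) q with h2 | h2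
    · rw [max_eq_right h2]; exact ⟨mq, hmq⟩
    · rw [max_eq_left h2]; exact ⟨-mK, by rw [hmK]; push_cast; ring⟩

/-- The invariant of a state: good pair, dyadic distance of order `prec`, `|d̂| ≤ M`. [folklore] -/
def Inv (M : ℚ) (s : ZZ × ℚ) : Prop := ZGood D s.1 ∧ (∃ m : ℤ, s.2 = m / 2 ^ prec) ∧ |s.2| ≤ M

variable {D prec}

/-- Size bookkeeping for the walk on codes (`Inv.mono`). [folklore] -/
theorem Inv.mono {M M' : ℚ} {s : ZZ × ℚ} (h : Inv D prec M s) (hM : M ≤ M') : Inv D prec M' s :=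
  ⟨h.1, h.2.1, h.2.2.trans hM⟩

/-- Size bookkeeping for the walk on codes (`inv_unit`). [folklore] -/
theorem inv_unit : Inv D prec 0 ((walkZ D prec).unit, 0) := ⟨zGood_unit D prec, ⟨0, by simp⟩, by simp⟩

/-- Size bookkeeping for the walk on codes (`inv_babyStep`). [folklore] -/
theorem inv_babyStep {M : ℚ} {s : ZZ × ℚ} (h : Inv D prec M s) :
    Inv D prec (M + (Gb D prec : ℕ)) ((walkZ D prec).babyStep s) := by
  obtain ⟨hz, ⟨m, hm⟩, hb⟩ := h
  obtain ⟨⟨m', hm'⟩, hg⟩ := ghat_bounds D prec hz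
  refine ⟨zGood_rho D prec hz, ⟨m + m', ?_⟩, ?_⟩
  · show s.2 + (walkZ D prec).ghat s.1 = _
    rw [hm, hm']; push_cast; ring
  · show |s.2 + (walkZ D prec).ghat s.1| ≤ _
    exact (abs_add_le _ _).trans (add_le_add hb hg)

/-- Size bookkeeping for the walk on codes (`inv_giantStep`). [folklore] -/
theorem inv_giantStep {M M' : ℚ} {s t : ZZ × ℚ} (hs : Inv D prec M s) (ht : Inv D prec M' t) :
    Inv D prec (M + M' + Kq D) ((walkZ D prec).giantStep s t) := by
  obtain ⟨hz, ⟨m, hm⟩, hb⟩ := hs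
  obtain ⟨-, ⟨m', hm'⟩, hb'⟩ := ht
  obtain ⟨⟨m'', hm''⟩, hk⟩ := khat_bounds D prec s.1 t.1
  refine ⟨zGood_star D prec hz, ⟨m + m' + m'', ?_⟩, ?_⟩
  · show s.2 + t.2 + (walkZ D prec).khat s.1 t.1 = _
    rw [hm, hm', hm'']; push_cast; ring
  · show |s.2 + t.2 + (walkZ D prec).khat s.1 t.1| ≤ _
    exact (abs_add_three _ _ _).trans (add_le_add (add_le_add hb hb') hk)

/-- Size bookkeeping for the walk on codes (`inv_startStep`). [folklore] -/
theorem inv_startStep {M : ℚ} {s : ZZ × ℚ} (h : Inv D prec M s) :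
    Inv D prec (M + (Gb D prec : ℕ)) ((walkZ D prec).startStep s) := by
  unfold startStep
  split_ifs
  · exact inv_babyStep h
  · exact h.mono (by linarith [show (0:ℚ) ≤ (Gb D prec : ℕ) by positivity])

/-- Size bookkeeping for the walk on codes (`inv_start`). [folklore] -/
theorem inv_start (s₀ : ℕ) : Inv D prec (s₀ * (Gb D prec : ℕ)) ((walkZ D prec).start s₀) := by
  unfold start
  induction s₀ with
  | zero => simpa using (inv_unit (D := D) (prec := prec))
  | succ n ih =>
    rw [Function.iterate_succ_apply']
    have := inv_startStep ih
    push_cast at this ⊢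
    exact this.mono (by ring_nf; exact le_rfl)

/-- The envelope of the doubling sequence: `2ᵏ(s₀ Gb + Kq) − Kq`. [folklore] -/
def Mdbl (D prec s₀ k : ℕ) : ℚ := 2 ^ k * ((s₀ : ℚ) * (Gb D prec : ℕ) + Kq D) - Kq D

/-- Size bookkeeping for the walk on codes (`inv_dbl`). [folklore] -/
theorem inv_dbl (s₀ : ℕ) : ∀ k, Inv D prec (Mdbl D prec s₀ k) ((walkZ D prec).dbl s₀ k)
  | 0 => by
    have := inv_start (D := D) (prec := prec) s₀
    exact this.mono (by unfold Mdbl; ring_nf; exact le_rfl)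
  | k + 1 => by
    rw [dbl]
    have := inv_giantStep (inv_dbl s₀ k) (inv_dbl s₀ k)
    exact this.mono (by unfold Mdbl; ring_nf; exact le_rfl)

/-- Size bookkeeping for the walk on codes (`Kq_nonneg`). [folklore] -/
theorem Kq_nonneg (D : ℕ) : (0 : ℚ) ≤ Kq D := by rw [← Kq_natCast]; positivity

/-- Size bookkeeping for the walk on codes (`Mdbl_nonneg`). [folklore] -/
theorem Mdbl_nonneg (s₀ k : ℕ) : (0 : ℚ) ≤ Mdbl D prec s₀ k := by
  unfold Mdbl
  have h1 : (1 : ℚ) ≤ 2 ^ k := one_le_pow₀ (by norm_num)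
  have h2 : (0 : ℚ) ≤ (s₀ : ℚ) * (Gb D prec : ℕ) := by positivity
  have h3 := Kq_nonneg D
  nlinarith

/-- Size bookkeeping for the walk on codes (`Mdbl_mono`). [folklore] -/
theorem Mdbl_mono (s₀ : ℕ) {k k' : ℕ} (h : k ≤ k') : Mdbl D prec s₀ k ≤ Mdbl D prec s₀ k' := by
  unfold Mdbl
  have h1 : (2 : ℚ) ^ k ≤ 2 ^ k' := pow_le_pow_right₀ (by norm_num) h
  have h2 : (0 : ℚ) ≤ (s₀ : ℚ) * (Gb D prec : ℕ) + Kq D := by have := Kq_nonneg D; positivity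
  nlinarith

/-- Size bookkeeping for the walk on codes (`inv_descStep`). [folklore] -/
theorem inv_descStep (x : ℚ) (s₀ : ℕ) {M : ℚ} {J : ZZ × ℚ} (h : Inv D prec M J) (k : ℕ) :
    Inv D prec (M + Mdbl D prec s₀ k + Kq D) ((walkZ D prec).descStep x s₀ J k) := by
  unfold descStep
  split_ifs
  · exact inv_giantStep h (inv_dbl s₀ k)
  · exact h.mono (by have := Mdbl_nonneg (D := D) (prec := prec) s₀ k; have := Kq_nonneg D; linarith)

/-- Along a fold of descent steps over levels `< T` the envelope grows by `Mdbl T + Kq` per level. [folklore] -/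
theorem inv_foldl_descStep (x : ℚ) (s₀ T : ℕ) (l : List ℕ) (hl : ∀ k ∈ l, k < T) {M : ℚ} {J : ZZ × ℚ}
    (h : Inv D prec M J) :
    Inv D prec (M + l.length * (Mdbl D prec s₀ T + Kq D)) (l.foldl ((walkZ D prec).descStep x s₀) J) := by
  induction l generalizing M J with
  | nil => simpa using h
  | cons k l ih =>
    rw [List.foldl_cons]
    have hk : k < T := hl k (by simp)
    have h1 := inv_descStep x s₀ h k
    have h2 : Inv D prec (M + (Mdbl D prec s₀ T + Kq D)) ((walkZ D prec).descStep x s₀ J k) :=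
      h1.mono (by have := Mdbl_mono (D := D) (prec := prec) s₀ hk.le; linarith)
    have h3 := ih (fun k' hk' => hl k' (by simp [hk'])) h2
    refine h3.mono ?_
    simp only [List.length_cons]; push_cast; ring_nf; exact le_rfl

/-- The envelope of the descent: `T (Mdbl T + Kq)`. [folklore] -/
def Mdesc (D prec s₀ T : ℕ) : ℚ := T * (Mdbl D prec s₀ T + Kq D)

/-- Size bookkeeping for the walk on codes (`inv_descent`). [folklore] -/
theorem inv_descent (x : ℚ) (s₀ T : ℕ) : Inv D prec (Mdesc D prec s₀ T) ((walkZ D prec).descent x s₀ T) := by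
  unfold descent descentFrom Mdesc
  have h := inv_foldl_descStep (D := D) (prec := prec) x s₀ T ((List.range' 0 (T - 0)).reverse)
    (fun k hk => by simp [List.mem_range'] at hk; omega) inv_unit
  simpa using h

/-- Size bookkeeping for the walk on codes (`inv_finStep`). [folklore] -/
theorem inv_finStep (x : ℚ) {M : ℚ} {J : ZZ × ℚ} (h : Inv D prec M J) :
    Inv D prec (M + (Gb D prec : ℕ)) ((walkZ D prec).finStep x J) := by
  unfold finStep
  split_ifs
  · exact inv_babyStep h
  · exact h.mono (by linarith [show (0:ℚ) ≤ (Gb D prec : ℕ) by positivity])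

/-- The envelope of the whole walk: `Mdesc + B·Gb`. [folklore] -/
def Mfin (D prec s₀ T B : ℕ) : ℚ := Mdesc D prec s₀ T + B * (Gb D prec : ℕ)

/-- **Every final state of the walk satisfies the invariant with envelope `Mfin`.** [folklore] -/
theorem inv_final (x : ℚ) (s₀ T B : ℕ) : Inv D prec (Mfin D prec s₀ T B) ((walkZ D prec).final x s₀ T B) := by
  unfold final Mfin
  induction B with
  | zero => simpa using inv_descent (D := D) (prec := prec) x s₀ T
  | succ n ih =>
    rw [Function.iterate_succ_apply']
    have := inv_finStep x ih
    push_cast at this ⊢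
    exact this.mono (by ring_nf; exact le_rfl)

end Invariants


/-! ### The walk programs on codes -/

section Programs

open WalkData

/-- The code of the parameters `(D, prec)` (`prec` unary). [folklore] -/
abbrev wE : ℕ × ℕ → List Bool := pairE natE unE

/-- The code of a state `((P, Q), d̂)`. [folklore] -/
abbrev stE : ZZ × ℚ → List Bool := pairE zzE encodeRat

/-! #### Size bookkeeping -/

/-- `size (zB D) ≤ size D + 3`. [folklore] -/
theorem size_zB_le (D : ℕ) : Nat.size (zB D) ≤ Nat.size D + 4 := by
  unfold zB
  have hs : Nat.sqrt D ≤ D := Nat.sqrt_le_self D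
  have h1 : Nat.size (2 * Nat.sqrt D + 2) ≤ Nat.size (4 * (D + 1)) := Nat.size_le_size (by omega)
  have h2 : Nat.size (4 * (D + 1)) = Nat.size (D + 1) + 2 := by
    rw [show 4 * (D + 1) = (D + 1) <<< 2 by rw [Nat.shiftLeft_eq]; ring, Nat.size_shiftLeft (by omega)]
  have h3 := size_add_le' D 1
  have h4 : Nat.size 1 = 1 := by decide
  omega

/-- **The code of a state under the invariant** is linearly bounded: good pair, dyadic distance of
order `prec` with `|d̂| ≤ A`. [folklore] -/
theorem length_stE_le {D prec A : ℕ} {M : ℚ} {s : ZZ × ℚ} (h : Inv D prec M s) (hA : M ≤ A) :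
    (stE s).length ≤ 18 * Nat.size D + 2 * Nat.size A + 3 * prec + 110 := by
  obtain ⟨hz, ⟨m, hm⟩, hb⟩ := h
  rw [show stE s = boolPair (zzE s.1) (encodeRat s.2) from rfl, length_boolPair, length_encodeRat]
  obtain ⟨b1, b2⟩ := hz.bounds
  have hzz := length_zzE_le b1 b2
  have hsz := size_zB_le D
  -- the rational: `den ≤ 2^prec`, `|num| ≤ A 2^prec`
  have hd : s.2.den ≤ 2 ^ prec := by
    have := (num_den_div_le m (k := 2 ^ prec) (by positivity)).2
    rw [← show (m : ℚ) / ((2 ^ prec : ℕ) : ℚ) = s.2 by rw [hm]; push_cast; rfl] ; exact this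
  have hA' : |s.2| ≤ (A : ℚ) := hb.trans hA
  have hn := natAbs_num_le hA' hd
  have h1 : Nat.size s.2.num.natAbs ≤ Nat.size A + prec + 1 := by
    refine (Nat.size_le_size hn).trans ?_
    have := size_mul_le A (2 ^ prec); rw [Nat.size_pow] at this; omega
  have h2 : Nat.size s.2.den ≤ prec + 1 := by
    have := Nat.size_le_size hd; rw [Nat.size_pow] at this; exact this
  omega

/-- The natural-number form of `Kq`. [folklore] -/
def KqN (D : ℕ) : ℕ := Ks D * (2 * Nat.size D + 3) + Nat.size D

/-- Size bookkeeping for the walk on codes (`KqN_cast`). [folklore] -/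
theorem KqN_cast (D : ℕ) : (KqN D : ℚ) = Kq D := rfl

/-- Size bookkeeping for the walk on codes (`Ks_le`). [folklore] -/
theorem Ks_le (D : ℕ) : Ks D ≤ Nat.size D + 4 := by
  unfold Ks
  have h1 := log_two_le_size (2 * D)
  rw [log_four_eq]
  have h2 : Nat.size (2 * D) ≤ Nat.size D + 1 := by
    rcases Nat.eq_zero_or_pos D with rfl | hD
    · simp
    · rw [show 2 * D = D <<< 1 by rw [Nat.shiftLeft_eq]; ring, Nat.size_shiftLeft hD.ne']
  omega

/-- `KqN D ≤ (L + 4)(2L + 3) + L` when `size D ≤ L`. [folklore] -/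
theorem KqN_le {D L : ℕ} (hD : Nat.size D ≤ L) : KqN D ≤ (L + 4) * (2 * L + 3) + L := by
  unfold KqN
  have := Ks_le D
  have : Ks D * (2 * Nat.size D + 3) ≤ (L + 4) * (2 * L + 3) := Nat.mul_le_mul (by omega) (by omega)
  omega

/-- `Gb D prec ≤ 8 (L + 4)` when `size D, prec ≤ L`. [folklore] -/
theorem Gb_le {D prec L : ℕ} (hD : Nat.size D ≤ L) (hp : prec ≤ L) : Gb D prec ≤ 8 * (L + 4) := by
  unfold Gb
  have h1 : Nat.size (3 * D + 3) ≤ Nat.size (4 * (D + 1)) := Nat.size_le_size (by omega)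
  have h2 : Nat.size (4 * (D + 1)) = Nat.size (D + 1) + 2 := by
    rw [show 4 * (D + 1) = (D + 1) <<< 2 by rw [Nat.shiftLeft_eq]; ring, Nat.size_shiftLeft (by omega)]
  have h3 := size_add_le' D 1
  have h4 : Nat.size 1 = 1 := by decide
  omega

/-- The common envelope `2^{L+4} (L + 4)^3` of all distances of the walk on inputs of length `L`. [folklore] -/
def Env (L : ℕ) : ℕ := 2 ^ (L + 4) * (L + 4) ^ 3

/-- Size bookkeeping for the walk on codes (`size_Env_le`). [folklore] -/
theorem size_Env_le (L : ℕ) : Nat.size (Env L) ≤ 4 * L + 18 := by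
  unfold Env
  have h1 := size_mul_le (2 ^ (L + 4)) ((L + 4) ^ 3)
  rw [Nat.size_pow] at h1
  have h2 := size_pow_le (L + 4) 3
  have h3 : Nat.size (L + 4) ≤ L + 4 := Nat.size_le.2 (Nat.lt_two_pow_self)
  omega

/-- The final envelope is below `Env L`: `Mfin ≤ Env L` when all parameters are `≤ L`. [folklore] -/
theorem Mfin_le_Env {D prec s₀ T B L : ℕ} (hD : Nat.size D ≤ L) (hp : prec ≤ L) (hs : s₀ ≤ L) (hT : T ≤ L)
    (hB : B ≤ L) : Mfin D prec s₀ T B ≤ (Env L : ℕ) := by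
  unfold Mfin Mdesc Mdbl Env
  have hG : ((Gb D prec : ℕ) : ℚ) ≤ 8 * ((L : ℚ) + 4) := by exact_mod_cast Gb_le hD hp
  have hK : Kq D ≤ ((L : ℚ) + 4) * (2 * L + 3) + L := by rw [← KqN_cast]; exact_mod_cast KqN_le hD
  have hK0 := Kq_nonneg D
  have hs' : (s₀ : ℚ) ≤ L := by exact_mod_cast hs
  have hT' : (T : ℚ) ≤ L := by exact_mod_cast hT
  have hB' : (B : ℚ) ≤ L := by exact_mod_cast hB
  have hL0 : (0 : ℚ) ≤ L := by positivity
  set Xq : ℚ := (L : ℚ) + 4 with hX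
  have hX4 : (4 : ℚ) ≤ Xq := by rw [hX]; linarith
  have hLX : (L : ℚ) ≤ Xq := by rw [hX]; linarith
  have hP1 : (1 : ℚ) ≤ 2 ^ L := one_le_pow₀ (by norm_num)
  have hpow : (2 : ℚ) ^ T ≤ 2 ^ L := pow_le_pow_right₀ (by norm_num) hT
  have hpow0 : (0 : ℚ) ≤ 2 ^ T := by positivity
  have hG0 : (0 : ℚ) ≤ (Gb D prec : ℕ) := by positivity
  -- `c₁ = s₀ Gb + Kq ≤ 10 X²`
  have hKX : Kq D ≤ 2 * Xq ^ 2 := by nlinarith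
  have hsG : (s₀ : ℚ) * (Gb D prec : ℕ) ≤ 8 * Xq ^ 2 := by nlinarith
  have hc1 : (s₀ : ℚ) * (Gb D prec : ℕ) + Kq D ≤ 10 * Xq ^ 2 := by linarith
  have hc1' : (0 : ℚ) ≤ (s₀ : ℚ) * (Gb D prec : ℕ) + Kq D := by positivity
  -- the three terms
  have h1 : (T : ℚ) * (2 ^ T * ((s₀ : ℚ) * (Gb D prec : ℕ) + Kq D) - Kq D) ≤ 10 * 2 ^ L * Xq ^ 3 := by
    have hT0 : (0 : ℚ) ≤ T := by positivity
    have hT1 : (1 : ℚ) ≤ 2 ^ T := one_le_pow₀ (by norm_num)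
    have : (2 : ℚ) ^ T * ((s₀ : ℚ) * (Gb D prec : ℕ) + Kq D) - Kq D ≤ 2 ^ L * (10 * Xq ^ 2) := by nlinarith
    have h0 : (0 : ℚ) ≤ (2 : ℚ) ^ T * ((s₀ : ℚ) * (Gb D prec : ℕ) + Kq D) - Kq D := by
      have hsG0 : (0 : ℚ) ≤ (s₀ : ℚ) * (Gb D prec : ℕ) := by positivity
      nlinarith
    calc (T : ℚ) * (2 ^ T * ((s₀ : ℚ) * (Gb D prec : ℕ) + Kq D) - Kq D) ≤ Xq * (2 ^ L * (10 * Xq ^ 2)) :=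
          mul_le_mul (hT'.trans hLX) this h0 (by linarith)
      _ = 10 * 2 ^ L * Xq ^ 3 := by ring
  have h2 : (T : ℚ) * Kq D ≤ 2 * 2 ^ L * Xq ^ 3 := by
    calc (T : ℚ) * Kq D ≤ Xq * (2 * Xq ^ 2) := mul_le_mul (hT'.trans hLX) hKX hK0 (by linarith)
      _ = 2 * 1 * Xq ^ 3 := by ring
      _ ≤ 2 * 2 ^ L * Xq ^ 3 := by nlinarith [pow_nonneg (show (0:ℚ) ≤ Xq by linarith) 3]
  have h3 : (B : ℚ) * (Gb D prec : ℕ) ≤ 2 * 2 ^ L * Xq ^ 3 := by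
    calc (B : ℚ) * (Gb D prec : ℕ) ≤ Xq * (8 * Xq) := mul_le_mul (hB'.trans hLX) hG hG0 (by linarith)
      _ = 8 * Xq ^ 2 * 1 * 1 := by ring
      _ ≤ 2 * Xq ^ 2 * Xq * 2 ^ L := by
          nlinarith [mul_nonneg (mul_nonneg (sq_nonneg Xq) (sub_nonneg.2 hX4)) (sub_nonneg.2 hP1), sq_nonneg Xq]
      _ = 2 * 2 ^ L * Xq ^ 3 := by ring
  push_cast
  rw [← hX, pow_add]
  have e : (T : ℚ) * (2 ^ T * ((s₀ : ℚ) * (Gb D prec : ℕ) + Kq D) - Kq D + Kq D) =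
      (T : ℚ) * (2 ^ T * ((s₀ : ℚ) * (Gb D prec : ℕ) + Kq D) - Kq D) + T * Kq D := by ring
  rw [e]
  norm_num
  nlinarith [pow_nonneg (show (0:ℚ) ≤ Xq by linarith) 3, h1, h2, h3]

/-! #### Straight-line pieces -/

/-- `babyStep` on codes. [cite: Jozsa2003, §9 Thm. 5] -/
theorem babyStepC : CodeFP (pairE wE stE) stE (fun p => (walkZ p.1.1 p.1.2).babyStep p.2) := by
  have hD : CodeFP (pairE wE stE) natE (fun p => p.1.1) := (fst _ _).fst'
  have hprec : CodeFP (pairE wE stE) unE (fun p => p.1.2) := (fst _ _).snd'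
  have hz : CodeFP (pairE wE stE) zzE (fun p => p.2.1) := (snd _ _).fst'
  have hd : CodeFP (pairE wE stE) encodeRat (fun p => p.2.2) := (snd _ _).snd'
  have hr := stepGC.comp (hD.pair hz)
  have hg := ghatQC.comp (hD.pair (hprec.pair hz))
  have h := hr.pair (ratAdd.comp (hd.pair hg))
  exact h.congr fun p => rfl

/-- `giantStep` on codes. [cite: Jozsa2003, §9 Thm. 5] -/
theorem giantStepC : CodeFP (pairE wE (pairE stE stE)) stE (fun p => (walkZ p.1.1 p.1.2).giantStep p.2.1 p.2.2) := by
  have hD : CodeFP (pairE wE (pairE stE stE)) natE (fun p => p.1.1) := (fst _ _).fst'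
  have hprec : CodeFP (pairE wE (pairE stE stE)) unE (fun p => p.1.2) := (fst _ _).snd'
  have hs : CodeFP (pairE wE (pairE stE stE)) stE (fun p => p.2.1) := (snd _ _).fst'
  have ht : CodeFP (pairE wE (pairE stE stE)) stE (fun p => p.2.2) := (snd _ _).snd'
  have hst := starGC.comp (hD.pair (hs.fst'.pair ht.fst'))
  have hk := khatQC.comp (hD.pair (hprec.pair (hs.fst'.pair ht.fst')))
  have h := hst.pair (ratAdd.comp ((ratAdd.comp (hs.snd'.pair ht.snd')).pair hk))
  exact h.congr fun p => rfl

/-- `2K + 1` on codes. [folklore] -/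
theorem twoKC : CodeFP wE encodeRat (fun w => 2 * Kq w.1 + 1) := by
  have hK : CodeFP wE encodeRat (fun w => Kq w.1) := (KqC.comp (fst _ _) :)
  have h := ratAdd.comp ((ratMul.comp ((const _ (2 : ℚ)).pair hK)).pair (const _ (1 : ℚ)))
  exact h.congr fun w => rfl

/-- `startStep` on codes. [cite: Jozsa2003, §9 Thm. 5] -/
theorem startStepC : CodeFP (pairE wE stE) stE (fun p => (walkZ p.1.1 p.1.2).startStep p.2) := by
  have hd : CodeFP (pairE wE stE) encodeRat (fun p => p.2.2) := (snd _ _).snd'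
  have hK : CodeFP (pairE wE stE) encodeRat (fun p => 2 * Kq p.1.1 + 1) := (twoKC.comp (fst _ _) :)
  have t : CodeFP (pairE wE stE) bitE (fun p => !decide (2 * Kq p.1.1 + 1 ≤ p.2.2)) := (ratLeC.comp (hK.pair hd)).not
  have h := ite t babyStepC (snd _ _)
  refine h.congr fun p => ?_
  show (if (!decide (2 * Kq p.1.1 + 1 ≤ p.2.2)) = true then _ else _) = _
  unfold startStep
  have e : (walkZ p.1.1 p.1.2).K = Kq p.1.1 := rfl
  rw [e]
  by_cases hc : p.2.2 < 2 * Kq p.1.1 + 1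
  · simp [hc, not_le.mpr hc]
  · simp [hc, not_lt.mp hc]

/-! #### The start-up fold -/

/-- **`start` on codes** (fold over `1^{s₀}` with the linear accumulator bound). [cite: Jozsa2003, §9 Thm. 5; AroraBarak2009, §1.3] -/
theorem startC : CodeFP (pairE wE unE) stE (fun p => (walkZ p.1.1 p.1.2).start p.2) := by
  have hstep : CodeFP (pairE wE (pairE unitE stE)) stE (fun t => (walkZ t.1.1 t.1.2).startStep t.2.2) :=
    (startStepC.comp ((fst _ _).pair (snd _ _).snd') :)
  have hinit : CodeFP wE stE (fun w => ((walkZ w.1 w.2).unit, (0 : ℚ))) := ((unitZC.comp (fst _ _)).pair (const _ (0 : ℚ)) :)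
  have h := foldl (σ := ℕ × ℕ) (α := Unit) (β := ZZ × ℚ) (eσ := wE) (eα := unitE) (eβ := stE)
    (step := fun w _ b => (walkZ w.1 w.2).startStep b) (init := fun w => ((walkZ w.1 w.2).unit, 0)) hstep hinit
    (C 29 * X + C 250) (fun w l₁ l₂ => by
      obtain ⟨D, prec⟩ := w
      rw [foldl_units_eq_iterate]
      simp only [eval_add, eval_mul, eval_C, eval_X, pairE_apply, length_boolPair, length_unE]
      set n := l₁.length
      set L := 2 * (2 * (natE D).length + 2 + prec) + 2 + (rawE unitE (l₁ ++ l₂)).length with hL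
      have hD : Nat.size D ≤ L := by rw [← length_natE]; omega
      have hp : prec ≤ L := by omega
      have hn : n ≤ L := by
        have := length_le_length_rawE unitE (l₁ ++ l₂); rw [List.length_append] at this; omega
      have hinv : Inv D prec (n * (Gb D prec : ℕ)) ((walkZ D prec).startStep^[n] ((walkZ D prec).unit, 0)) := inv_start n
      have hM : (n : ℚ) * (Gb D prec : ℕ) ≤ (Env L : ℕ) := by
        have := Mfin_le_Env (D := D) (prec := prec) (s₀ := 0) (T := 0) (B := n) hD hp (Nat.zero_le _) (Nat.zero_le _) hn
        unfold Mfin Mdesc at this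
        simpa using this
      have hlen := length_stE_le hinv hM
      rw [show ∀ s, stE s = boolPair (zzE s.1) (encodeRat s.2) from fun _ => rfl,
        show ∀ z : ZZ, zzE z = boolPair (intE z.1) (intE z.2) from fun _ => rfl, length_boolPair, length_boolPair] at hlen
      have hE := size_Env_le L
      omega)
  have h' := h.comp ((fst _ _).pair (replicateUnit.comp (snd wE unE)))
  refine h'.congr fun p => ?_
  show (List.replicate p.2 ()).foldl (fun b _ => (walkZ p.1.1 p.1.2).startStep b) ((walkZ p.1.1 p.1.2).unit, 0) = _
  rw [foldl_units_eq_iterate, List.length_replicate]; rfl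

end Programs


section Programs2

open WalkData

/-! #### The doubling fold -/

/-- `Mdbl k ≤ Mfin s₀ L 0` when `k + 1 ≤ L`. [folklore] -/
theorem Mdbl_le_Mfin {D prec s₀ k L : ℕ} (hk : k + 1 ≤ L) : Mdbl D prec s₀ k ≤ Mfin D prec s₀ L 0 := by
  unfold Mfin Mdesc
  have h1 := Mdbl_mono (D := D) (prec := prec) s₀ (show k ≤ L by omega)
  have h2 := Mdbl_nonneg (D := D) (prec := prec) s₀ L
  have h3 := Kq_nonneg D
  have hL : (1 : ℚ) ≤ L := by exact_mod_cast (show 1 ≤ L by omega)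
  push_cast
  nlinarith

/-- **`dbl` on codes**: `k` giant self-steps from `start s₀` (`s₀`, `k` unary). [cite: Jozsa2003, §7.1 Prop. 35, §9 Thm. 5] -/
theorem dblC : CodeFP (pairE (pairE wE unE) unE) stE (fun p => (walkZ p.1.1.1 p.1.1.2).dbl p.1.2 p.2) := by
  have hstep : CodeFP (pairE (pairE wE unE) (pairE unitE stE)) stE (fun t => (walkZ t.1.1.1 t.1.1.2).giantStep t.2.2 t.2.2) :=
    (giantStepC.comp ((fst _ _).fst'.pair ((snd _ _).snd'.pair (snd _ _).snd')) :)
  have hinit : CodeFP (pairE wE unE) stE (fun s => (walkZ s.1.1 s.1.2).start s.2) := startC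
  have h := foldl (σ := (ℕ × ℕ) × ℕ) (α := Unit) (β := ZZ × ℚ) (eσ := pairE wE unE) (eα := unitE) (eβ := stE)
    (step := fun s _ b => (walkZ s.1.1 s.1.2).giantStep b b) (init := fun s => (walkZ s.1.1 s.1.2).start s.2) hstep hinit
    (C 29 * X + C 250) (fun s l₁ l₂ => by
      obtain ⟨⟨D, prec⟩, s₀⟩ := s
      rw [foldl_units_eq_iterate]
      simp only [eval_add, eval_mul, eval_C, eval_X, pairE_apply, length_boolPair, length_unE]
      set n := l₁.length
      set L := 2 * (2 * (2 * (natE D).length + 2 + prec) + 2 + s₀) + 2 + (rawE unitE (l₁ ++ l₂)).length with hL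
      have hD : Nat.size D ≤ L := by rw [← length_natE]; omega
      have hp : prec ≤ L := by omega
      have hs : s₀ ≤ L := by omega
      have hn : n + 1 ≤ L := by
        have := length_le_length_rawE unitE (l₁ ++ l₂); rw [List.length_append] at this; omega
      have hdbl : ∀ k, (fun b => (walkZ D prec).giantStep b b)^[k] ((walkZ D prec).start s₀) = (walkZ D prec).dbl s₀ k := by
        intro k; induction k with
        | zero => rfl
        | succ k ih => rw [Function.iterate_succ_apply', ih]; rfl
      rw [hdbl]
      have hinv := inv_dbl (D := D) (prec := prec) s₀ n
      have hM : Mdbl D prec s₀ n ≤ (Env L : ℕ) :=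
        (Mdbl_le_Mfin hn).trans (Mfin_le_Env hD hp hs le_rfl (Nat.zero_le _))
      have hlen := length_stE_le hinv hM
      rw [show ∀ s, stE s = boolPair (zzE s.1) (encodeRat s.2) from fun _ => rfl,
        show ∀ z : ZZ, zzE z = boolPair (intE z.1) (intE z.2) from fun _ => rfl, length_boolPair, length_boolPair] at hlen
      have hE := size_Env_le L
      omega)
  have h' := h.comp ((fst _ _).pair (replicateUnit.comp (snd (pairE wE unE) unE)))
  refine h'.congr fun p => ?_
  show (List.replicate p.2 ()).foldl (fun b _ => (walkZ p.1.1.1 p.1.1.2).giantStep b b) ((walkZ p.1.1.1 p.1.1.2).start p.1.2) = _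
  rw [foldl_units_eq_iterate, List.length_replicate]
  induction p.2 with
  | zero => rfl
  | succ k ih => rw [Function.iterate_succ_apply', ih]; rfl

/-! #### The descent fold -/

/-- The code of the descent context `((D, prec), x), (s₀, T)` (`s₀`, `T` unary). [folklore] -/
abbrev dcE : ((ℕ × ℕ) × ℚ) × (ℕ × ℕ) → List Bool := pairE (pairE wE encodeRat) (pairE unE unE)

/-- The descent step with the level capped at `T` (equal to `descStep` on the levels `< T` that
actually occur; the cap keeps the program polynomial on every level list). [folklore] -/
def descStepT (D prec : ℕ) (x : ℚ) (s₀ T : ℕ) (J : ZZ × ℚ) (k : ℕ) : ZZ × ℚ :=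
  (walkZ D prec).descStep x s₀ J (min k T)

/-- `descStepT` on codes. [cite: Jozsa2003, §9 Thm. 5] -/
theorem descStepTC : CodeFP (pairE dcE (pairE natE stE)) stE
    (fun t => descStepT t.1.1.1.1 t.1.1.1.2 t.1.1.2 t.1.2.1 t.1.2.2 t.2.2 t.2.1) := by
  let E : (((ℕ × ℕ) × ℚ) × (ℕ × ℕ)) × (ℕ × (ZZ × ℚ)) → List Bool := pairE dcE (pairE natE stE)
  have hw : CodeFP E wE (fun t => t.1.1.1) := (fst _ _).fst'.fst'
  have hx : CodeFP E encodeRat (fun t => t.1.1.2) := (fst _ _).fst'.snd'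
  have hs₀ : CodeFP E unE (fun t => t.1.2.1) := (fst _ _).snd'.fst'
  have hT : CodeFP E unE (fun t => t.1.2.2) := (fst _ _).snd'.snd'
  have hk : CodeFP E natE (fun t => t.2.1) := (snd _ _).fst'
  have hJ : CodeFP E stE (fun t => t.2.2) := (snd _ _).snd'
  have hku : CodeFP E unE (fun t => min t.2.1 t.1.2.2) := (unOfNatMin.comp (hT.pair hk) :)
  have hd : CodeFP E stE (fun t => (walkZ t.1.1.1.1 t.1.1.1.2).dbl t.1.2.1 (min t.2.1 t.1.2.2)) :=
    (dblC.comp ((hw.pair hs₀).pair hku) :)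
  have hg : CodeFP E stE (fun t => (walkZ t.1.1.1.1 t.1.1.1.2).giantStep t.2.2
      ((walkZ t.1.1.1.1 t.1.1.1.2).dbl t.1.2.1 (min t.2.1 t.1.2.2))) := (giantStepC.comp (hw.pair (hJ.pair hd)) :)
  have t : CodeFP E bitE (fun t => decide (((walkZ t.1.1.1.1 t.1.1.1.2).giantStep t.2.2
      ((walkZ t.1.1.1.1 t.1.1.1.2).dbl t.1.2.1 (min t.2.1 t.1.2.2))).2 ≤ t.1.1.2)) := (ratLeC.comp (hg.snd'.pair hx) :)
  have h := ite t hg hJ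
  refine h.congr fun t => ?_
  unfold descStepT descStep
  by_cases hc : ((walkZ t.1.1.1.1 t.1.1.1.2).giantStep t.2.2 ((walkZ t.1.1.1.1 t.1.1.1.2).dbl t.1.2.1 (min t.2.1 t.1.2.2))).2 ≤ t.1.1.2
  · simp [hc]
  · simp [hc]

/-- Folding the capped step over capped levels is folding `descStep`. [folklore] -/
theorem foldl_descStepT (D prec : ℕ) (x : ℚ) (s₀ T : ℕ) (l : List ℕ) (J : ZZ × ℚ) :
    l.foldl (descStepT D prec x s₀ T) J = (l.map fun k => min k T).foldl ((walkZ D prec).descStep x s₀) J := by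
  rw [List.foldl_map]; rfl

/-- The invariant along a fold of capped descent steps (any level list). [folklore] -/
theorem inv_foldl_descStepT (D prec : ℕ) (x : ℚ) (s₀ T : ℕ) (l : List ℕ) :
    Inv D prec (l.length * (Mdbl D prec s₀ (T + 1) + Kq D))
      (l.foldl (fun J k => descStepT D prec x s₀ T J k) ((walkZ D prec).unit, 0)) := by
  have h := inv_foldl_descStep (D := D) (prec := prec) x s₀ (T + 1) (l.map fun k => min k T)
    (fun k hk => by obtain ⟨k', -, rfl⟩ := List.mem_map.1 hk; exact Nat.lt_succ_of_le (min_le_right _ _)) inv_unit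
  rw [List.length_map, zero_add, ← foldl_descStepT] at h
  exact h

/-- **`descent` on codes**: the fold of the capped step over the levels `T−1, …, 0`. [cite: Jozsa2003, §9 Thm. 5] -/
theorem descentC : CodeFP dcE stE (fun c => (walkZ c.1.1.1 c.1.1.2).descent c.1.2 c.2.1 c.2.2) := by
  have hstep := descStepTC
  have hinit : CodeFP dcE stE (fun c => ((walkZ c.1.1.1 c.1.1.2).unit, (0 : ℚ))) :=
    ((unitZC.comp (fst _ _).fst'.fst').pair (const _ (0 : ℚ)) :)
  have h := foldl (σ := ((ℕ × ℕ) × ℚ) × (ℕ × ℕ)) (α := ℕ) (β := ZZ × ℚ) (eσ := dcE) (eα := natE) (eβ := stE)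
    (step := fun c k J => descStepT c.1.1.1 c.1.1.2 c.1.2 c.2.1 c.2.2 J k)
    (init := fun c => ((walkZ c.1.1.1 c.1.1.2).unit, 0)) hstep hinit
    (C 29 * X + C 250) (fun c l₁ l₂ => by
      obtain ⟨⟨⟨D, prec⟩, x⟩, s₀, T⟩ := c
      simp only [eval_add, eval_mul, eval_C, eval_X, pairE_apply, length_boolPair, length_unE]
      set n := l₁.length
      set L := 2 * (2 * (2 * (2 * (natE D).length + 2 + prec) + 2 + (encodeRat x).length) + 2 + (2 * s₀ + 2 + T)) + 2 +
        (rawE natE (l₁ ++ l₂)).length with hL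
      have hD : Nat.size D ≤ L := by rw [← length_natE]; omega
      have hp : prec ≤ L := by omega
      have hs : s₀ ≤ L := by omega
      have hT : T + 1 ≤ L := by omega
      have hn : n ≤ L := by
        have := length_le_length_rawE natE (l₁ ++ l₂); rw [List.length_append] at this; omega
      have hinv := inv_foldl_descStepT D prec x s₀ T l₁
      have hM : (n : ℚ) * (Mdbl D prec s₀ (T + 1) + Kq D) ≤ (Env L : ℕ) := by
        refine le_trans ?_ (Mfin_le_Env (s₀ := s₀) (T := L) (B := 0) hD hp hs le_rfl (Nat.zero_le _))
        unfold Mfin Mdesc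
        have h1 := Mdbl_mono (D := D) (prec := prec) s₀ hT
        have h2 := Mdbl_nonneg (D := D) (prec := prec) s₀ (T + 1)
        have h3 := Kq_nonneg D
        have hn' : (n : ℚ) ≤ L := by exact_mod_cast hn
        push_cast
        nlinarith
      have hlen := length_stE_le hinv hM
      rw [show ∀ s, stE s = boolPair (zzE s.1) (encodeRat s.2) from fun _ => rfl,
        show ∀ z : ZZ, zzE z = boolPair (intE z.1) (intE z.2) from fun _ => rfl, length_boolPair, length_boolPair] at hlen
      have hE := size_Env_le L
      omega)
  -- the level list `[T−1, …, 0] = (range T).map (T − 1 − ·)`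
  have hTn : CodeFP dcE natE (fun c => c.2.2) := (natOfUn.comp (snd _ _).snd' :)
  have hsub : CodeFP (pairE dcE natE) natE (fun t => t.1.2.2 - 1 - t.2) :=
    (natSub.comp ((natSub.comp ((hTn.comp (fst _ _)).pair (const _ (1 : ℕ)))).pair (snd _ _)) :)
  have hlv : CodeFP dcE (rawE natE) (fun c => (List.range c.2.2).map fun i => c.2.2 - 1 - i) :=
    ((map (σ := ((ℕ × ℕ) × ℚ) × (ℕ × ℕ)) (eσ := dcE) hsub).comp ((CodeFP.id dcE).pair (urange.comp (snd _ _).snd')) :)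
  have h' := h.comp ((CodeFP.id dcE).pair hlv)
  refine h'.congr fun c => ?_
  obtain ⟨⟨⟨D, prec⟩, x⟩, s₀, T⟩ := c
  show ((List.range T).map fun i => T - 1 - i).foldl (descStepT D prec x s₀ T) ((walkZ D prec).unit, 0) =
    (walkZ D prec).descent x s₀ T
  rw [foldl_descStepT, List.map_map, descent, descentFrom, List.reverse_range', Nat.sub_zero]
  congr 1
  refine List.map_congr_left fun i hi => ?_
  rw [List.mem_range] at hi
  show min (T - 1 - i) T = 0 + T - 1 - i
  rw [min_eq_left (by omega)]; omega

/-! #### The final walk and the table -/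

/-- `finStep` on codes. [cite: Jozsa2003, §9 Thm. 5] -/
theorem finStepC : CodeFP (pairE (pairE wE encodeRat) stE) stE (fun p => (walkZ p.1.1.1 p.1.1.2).finStep p.1.2 p.2) := by
  have hw : CodeFP (pairE (pairE wE encodeRat) stE) wE (fun p => p.1.1) := (fst _ _).fst'
  have hx : CodeFP (pairE (pairE wE encodeRat) stE) encodeRat (fun p => p.1.2) := (fst _ _).snd'
  have hJ : CodeFP (pairE (pairE wE encodeRat) stE) stE (fun p => p.2) := snd _ _
  have hb : CodeFP (pairE (pairE wE encodeRat) stE) stE (fun p => (walkZ p.1.1.1 p.1.1.2).babyStep p.2) := (babyStepC.comp (hw.pair hJ) :)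
  have t : CodeFP (pairE (pairE wE encodeRat) stE) bitE (fun p => decide (((walkZ p.1.1.1 p.1.1.2).babyStep p.2).2 ≤ p.1.2)) :=
    (ratLeC.comp (hb.snd'.pair hx) :)
  have h := ite t hb hJ
  refine h.congr fun p => ?_
  unfold finStep
  by_cases hc : ((walkZ p.1.1.1 p.1.1.2).babyStep p.2).2 ≤ p.1.2
  · simp [hc]
  · simp [hc]

/-- **`final` on codes**: `B` final rounds after the descent (`B` unary). [cite: Jozsa2003, §9 Thm. 5] -/
theorem finalC : CodeFP (pairE dcE unE) stE (fun p => (walkZ p.1.1.1.1 p.1.1.1.2).final p.1.1.2 p.1.2.1 p.1.2.2 p.2) := by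
  have hstep : CodeFP (pairE dcE (pairE unitE stE)) stE (fun t => (walkZ t.1.1.1.1 t.1.1.1.2).finStep t.1.1.2 t.2.2) :=
    (finStepC.comp ((fst _ _).fst'.pair (snd _ _).snd') :)
  have hinit : CodeFP dcE stE (fun c => (walkZ c.1.1.1 c.1.1.2).descent c.1.2 c.2.1 c.2.2) := descentC
  have h := foldl (σ := ((ℕ × ℕ) × ℚ) × (ℕ × ℕ)) (α := Unit) (β := ZZ × ℚ) (eσ := dcE) (eα := unitE) (eβ := stE)
    (step := fun c _ J => (walkZ c.1.1.1 c.1.1.2).finStep c.1.2 J)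
    (init := fun c => (walkZ c.1.1.1 c.1.1.2).descent c.1.2 c.2.1 c.2.2) hstep hinit
    (C 29 * X + C 250) (fun c l₁ l₂ => by
      obtain ⟨⟨⟨D, prec⟩, x⟩, s₀, T⟩ := c
      rw [foldl_units_eq_iterate]
      simp only [eval_add, eval_mul, eval_C, eval_X, pairE_apply, length_boolPair, length_unE]
      set n := l₁.length
      set L := 2 * (2 * (2 * (2 * (natE D).length + 2 + prec) + 2 + (encodeRat x).length) + 2 + (2 * s₀ + 2 + T)) + 2 +
        (rawE unitE (l₁ ++ l₂)).length with hL
      have hD : Nat.size D ≤ L := by rw [← length_natE]; omega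
      have hp : prec ≤ L := by omega
      have hs : s₀ ≤ L := by omega
      have hT : T ≤ L := by omega
      have hn : n ≤ L := by
        have := length_le_length_rawE unitE (l₁ ++ l₂); rw [List.length_append] at this; omega
      have hinv : Inv D prec (Mfin D prec s₀ T n) (((walkZ D prec).finStep x)^[n] ((walkZ D prec).descent x s₀ T)) :=
        inv_final x s₀ T n
      have hM : Mfin D prec s₀ T n ≤ (Env L : ℕ) := Mfin_le_Env hD hp hs hT hn
      have hlen := length_stE_le hinv hM
      rw [show ∀ s, stE s = boolPair (zzE s.1) (encodeRat s.2) from fun _ => rfl,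
        show ∀ z : ZZ, zzE z = boolPair (intE z.1) (intE z.2) from fun _ => rfl, length_boolPair, length_boolPair] at hlen
      have hE := size_Env_le L
      omega)
  have h' := h.comp ((fst _ _).pair (replicateUnit.comp (snd dcE unE)))
  refine h'.congr fun p => ?_
  show (List.replicate p.2 ()).foldl (fun J _ => (walkZ p.1.1.1.1 p.1.1.1.2).finStep p.1.1.2 J)
    ((walkZ p.1.1.1.1 p.1.1.1.2).descent p.1.1.2 p.1.2.1 p.1.2.2) = _
  rw [foldl_units_eq_iterate, List.length_replicate]; rfl

/-- The code of the table input `(((D, prec), (s₀, T, B)), (N, v))` (`prec, s₀, T, B` unary; `D, N` binary;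
`v` an integer). [folklore] -/
abbrev tbE : ((ℕ × ℕ) × (ℕ × ℕ × ℕ)) × (ℕ × ℤ) → List Bool :=
  pairE (pairE wE (pairE unE (pairE unE unE))) (pairE natE intE)

/-- Ceiling of a rational as an integer division: `⌈q⌉ = −((−q).num div (−q).den)`. [folklore] -/
theorem ratCeilC : CodeFP encodeRat intE (fun q => ⌈q⌉) := by
  have hn : CodeFP encodeRat encodeRat (fun q => -q) := ((ratMul.comp ((const _ (-1 : ℚ)).pair (CodeFP.id encodeRat))).congr fun q => by
    show (-1) * q = -q; ring)
  have hnd := ratNumDen.comp hn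
  have hfl : CodeFP encodeRat intE (fun q => (-q).num / ((-q).den : ℤ)) := (intEDiv.comp (hnd.fst'.pair (intOfNat.comp hnd.snd')) :)
  have h := intNeg.comp hfl
  refine h.congr fun q => ?_
  show -((-q).num / ((-q).den : ℤ)) = ⌈q⌉
  rw [← Rat.floor_intCast_div_natCast, Rat.num_div_den, Int.floor_neg, neg_neg]

/-- **Hallgren's table on codes**: `v ↦ (label, v − ⌈N d̂⌉)` of the walk to `x = v/N` is computed
on codes by a polynomial-time string function, as a function of ALL its inputs
`(D, prec, s₀, T, B, N, v)`. [cite: Jozsa2003, §9 Thm. 5, §10 (h̃_N)] -/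
theorem tableZC : CodeFP tbE (pairE zzE intE)
    (fun p => (walkZ p.1.1.1 p.1.1.2).table p.2.1 p.1.2.1 p.1.2.2.1 p.1.2.2.2 p.2.2) := by
  have hw : CodeFP tbE wE (fun p => p.1.1) := (fst _ _).fst'
  have hs₀ : CodeFP tbE unE (fun p => p.1.2.1) := (fst _ _).snd'.fst'
  have hT : CodeFP tbE unE (fun p => p.1.2.2.1) := (fst _ _).snd'.snd'.fst'
  have hB : CodeFP tbE unE (fun p => p.1.2.2.2) := (fst _ _).snd'.snd'.snd'
  have hN : CodeFP tbE natE (fun p => p.2.1) := (snd _ _).fst'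
  have hv : CodeFP tbE intE (fun p => p.2.2) := (snd _ _).snd'
  have hx : CodeFP tbE encodeRat (fun p => (p.2.2 : ℚ) / (p.2.1 : ℚ)) := (ratOfIntNat.comp (hv.pair hN) :)
  have hfin : CodeFP tbE stE (fun p => (walkZ p.1.1.1 p.1.1.2).final ((p.2.2 : ℚ) / (p.2.1 : ℚ)) p.1.2.1 p.1.2.2.1 p.1.2.2.2) :=
    (finalC.comp (((hw.pair hx).pair (hs₀.pair hT)).pair hB) :)
  have hNd : CodeFP tbE encodeRat (fun p => (p.2.1 : ℚ) * ((walkZ p.1.1.1 p.1.1.2).final ((p.2.2 : ℚ) / (p.2.1 : ℚ)) p.1.2.1 p.1.2.2.1 p.1.2.2.2).2) :=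
    (ratMul.comp ((ratOfNat'.comp hN).pair hfin.snd') :)
  have hoff : CodeFP tbE intE (fun p => p.2.2 - ⌈(p.2.1 : ℚ) * ((walkZ p.1.1.1 p.1.1.2).final ((p.2.2 : ℚ) / (p.2.1 : ℚ)) p.1.2.1 p.1.2.2.1 p.1.2.2.2).2⌉) :=
    (intSub.comp (hv.pair (ratCeilC.comp hNd)) :)
  have h := hfin.fst'.pair hoff
  exact h.congr fun p => rfl

/-- **Hallgren's table `(principalWalk D prec).table` is polynomial-time computable on codes**
(read back through `ofZ`; Jozsa 2003, Thm. 5: "The function `h` is computable in polynomial time").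
[cite: Jozsa2003, §9 Thm. 5] -/
theorem principalTableC : CodeFP tbE (pairE zzE intE)
    (fun p => Prod.map toZ id ((principalWalk p.1.1.1 p.1.1.2).table p.2.1 p.1.2.1 p.1.2.2.1 p.1.2.2.2 p.2.2)) :=
  tableZC.congr fun p => (principalWalk_table_eq p.1.1.1 p.1.1.2 _ _ _ _ _).symm

end Programs2

end Hallgren2007

end Literature.Computability.Cryptography

end
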